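import Literature.MathematicalPhysics.QuantumFieldTheory.Balaban1983to89.B7Prop3GeneralTild
import Literature.MathematicalPhysics.QuantumFieldTheory.Balaban1983to89.B7Prop4GeneralLevels
import Literature.MathematicalPhysics.QuantumFieldTheory.Balaban1983to89.B7AvgGaugeCovariance
import Literature.MathematicalPhysics.QuantumFieldTheory.Balaban1983to89.B8Eq119TwistedAxial
import Literature.MathematicalPhysics.QuantumFieldTheory.Balaban1983to89.B8Ineq132
import Literature.MathematicalPhysics.QuantumFieldTheory.Balaban1983to89.B9Eq3113Proof
import Literature.MathematicalPhysics.QuantumFieldTheory.Balaban1983to89.B7Eq99Concrete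
import Literature.MathematicalPhysics.QuantumFieldTheory.Balaban1983to89.B9Eq3169Mu

/-!
# `Balaban1983to89.B9Eq3114Proof` — T. Bałaban, *Propagators for lattice gauge theories in a background field*,
# Commun. Math. Phys. **99** (1985) 389–434 [Balaban1985BackgroundPropagators]: (3.114)–(3.115) p. 418 — the averaging
# operators on linear gauge transformations, `(QD^{L⁻¹}λ)(c) = R̄_c(Q′λ)(c₊) − (Q′λ)(c₋) = (D_ŪQ′λ)(c)` and `Q_jDλ = D̄ʲQ′_jλ`,
# PROVED as exact identities for the paper's own linear one-step averaging operator at a general background, with the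
# invariance of `Q_jA` under `λ ∈ N(Q′_j)`

statement-level skeleton of published theorems with citation tags; proofs where landed; nothing here is a claim about the Yang–Mills mass gap

PDF held: `paper:balaban1985-cmp99-background-propagators` (journal page = PDF page + 388); [5] = [Balaban1985Averaging]
`paper:balaban1985-cmp98-averaging` (journal page = PDF page + 16).  READ AS IMAGES for this module (renders `b2b-balaban-ref1/
pages/…`): B9 pp. 390, 392–393, 417–418 [PDF 2, 4–5, 29–30]; B7 pp. 30–31 [PDF 14–15].

WHAT IS REPRODUCED.  SKELETON row **B9.Eq3.113** (cell `lit-balaban`, Phase 2, seat p15 = reserve R10 «B9.Eq3.113 knitting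
(3.114)/(3.115) on models», referee ref-4; HOME `run/shared/lean/pub/lit-balaban/`, seat dir `lit-balaban-p15/`): the two
LINEAR identities (3.114), (3.115) and the sentence after them, on the concrete `ℤᵈ` carrier of the b07 lineage
(`B7Prop1Explicit`/`B7Eq92Concrete`/`B7Prop3GeneralLinear`).  (3.113) itself (the non-linear averages `R_yU′‾`, `Ū′_c`) stays
typed BY IDENTIFICATION with [5] (`B7Eq92Concrete.wframe`/`dbavgCov`, `B7Eq99Concrete.R0avg`) as the row records; not restated.

THE PRINTED TEXT (p. 418, verbatim).  *"We consider the one-step average Ū′_c = (R_{c₋}U′‾)⁻¹(U′U)‾_c(Ū_c)⁻¹R̄_cR_{c₊}U′‾, where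
R_yU′‾ = exp[i Σ_{x∈B(y)} L^{−d}(1/i) log(R_yU′)(Γ_{y,x})], (3.113) and we calculate it for U′^u with U′ = 1, thus for
U′(x,x′) = u(x)R(U(x,x′))u⁻¹(x′). We have (U′U)‾_c = u(c₋)Ū_cu⁻¹(c₊), and (U′U)‾_c(Ū_c)⁻¹ = u(c₋)R̄_cu⁻¹(c₊). Next we get
R_yU′‾ = … = u(y)(R̄u)⁻¹(y), hence Ū′_c = (R̄u)(c₋)R̄_c(R̄u)⁻¹(c₊). Taking logarithms of both sides, and linear parts in λ, we
obtain (QD^{L⁻¹}λ)(c) = R̄_c(Q′λ)(c₊) − (Q′λ)(c₋) = (D_ŪQ′λ)(c). (3.114)  Iterating this identity we obtain finally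
Q_jDλ = D^{Lʲη}_{Ūʲ}Q′_jλ = D̄ʲQ′_jλ, (3.115) where the last equality is a definition of the symbol D̄ʲ. These equalities are
simple generalizations of the identity Q_k∂ = ∂¹Q′_k used in [3,4]. In particular they imply that the average QA are invariant
with respect to gauge transformations λ satisfying Q′λ = 0, i.e. λ∈N(Q′)."*  Inputs: p. 390 *"(D^η_{U₀}A)(b) =
η⁻¹(R(U₀(b))A(b₊) − A(b₋))"*; p. 393 (3.14)–(3.15) *"(1/(Lʲη))Q_j(U, ηA) = Q_j(U)A + (1/(Lʲη))C_j(U, LʲηA) … Q_j(U) =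
Q(Ūʲ⁻¹)·…·Q(Ū)Q(U), (3.15) where Q(V) is given by the explicit formula (124) in [5]"*; (3.18)–(3.19) *"(Q′(V)λ)(y) =
Σ_{x∈B(y)} L^{−d}R(V(Γ_{y,x}))λ(x), (Q′_j(U)λ)(y) = (Q′(Ūʲ⁻¹)·…·Q′(Ū)Q′(U)λ)(y)"*.

DICTIONARY print ↦ Lean (b07 conventions: every level `ℤᵈ`, `L`-bond `c = ⟨q, q + Le_κ⟩ ↦ (q, κ)`, `B(c₋) = q + [0,L)ᵈ`
(`boxVec`), `Γ_{y,x} = treeWord (x − y)` from `y`, `R(X)Y = XYX⁻¹ = conjR X Y`, unit-valued fields in a complete normed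
`ℂ`-algebra `𝔸`, `i`, `η` absorbed).  `Q(U)` of (3.14)/(3.15) ((122)/(124) of [5]) ↦ `B7Prop3GeneralLinear.linQcov L U` (by
(3.14) at `j = 1` it is `Lη·(Q(U)·)_c`); `D = D^η_U` (p. 390) ↦ `B8Ineq132.covDerivFwd η U` at `η = 1`, `(Dλ)(x, μ) =
R(U(x,x+e_μ))λ(x+e_μ) − λ(x)` — with the fine lattice `L⁻¹ℤᵈ` of (3.114), `D^{L⁻¹} = L·D¹` and `Q(U) = L⁻¹·linQcov`, so
`(QD^{L⁻¹}λ)(c)` IS `linQcov L U (D¹λ) c`, the form proved; `(Q′(V)λ)(y)` (3.18) ↦ `Σ_r L^{−d} conjR (hol V y Γ_{y,y+r}) λ(y+r)`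
(spelled out in `eq3114`) = the tree's `B7Eq78Linearization.Qprime` on `blockSites L y` with the transporters
`B8Eq119TwistedAxial.bgT` (`Qprime_bgT`); `Q′_j` (3.19) ↦ `B7Eq78Linearization.QprimeIter (zdBlocking d L) (bgT L U) j` (the
tree object with the PROVED "Q′_j = linear part of R̄₀uʲ", `hasDerivAt_invI_smul_mlog_Rbar_zd`); `Ū_c`/`R̄_c` ↦ `bavg L U q κ`/
`conjR (bavg …)` (`B7Prop1Explicit`); `Ūʲ` ↦ `B7Prop2Explicit.avgIter L U j`; `Q_j(U)` (3.15), un-normalised ↦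
`B7Prop4GeneralLevels.linCovIter L U · j`; `D̄ʲ = D¹_{Ūʲ}` on the level-`j` lattice `≅ ℤᵈ` ↦ `covDerivFwd 1 (avgIter L U j)`.

WHAT THIS FILE PROVES (kernel-checked, 0 sorry, standard axioms; the ONLY hypotheses are the displayed loop conditions
`‖W_x(V) − 1‖ < 1` on the blocks — the disc of the series logarithm (21) of [5], under which the tree's closed form
`B7Prop3GeneralTild.linQcov_eq` holds; [5] Prop. 2 provides them at every level, `eq3115_of_prop2`).
§1 `tsum_covD` — `(R_{0,y}Dλ)(Γ) = R(V(Γ))λ(y + Γ) − λ(y)` along ANY word; `FhatCov_covD` — the frame exponent (112) of [5] at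
`A = Dλ` is `(Q′(V)λ)(y) − λ(y)` (linear part of print's `R_yU′‾ = u(y)(R̄u)⁻¹(y)`).  §2 `QprimeCov_covD` — the tilde part
(119) of [5] at `A = Dλ` is `R̄_cλ(c₊) − λ(c₋)` (linear part of `(U′U)‾_c(Ū_c)⁻¹ = u(c₋)R̄_cu⁻¹(c₊)`), via the commutator
identities `(D log)_W(WZ − ZW) = (log W)Z − Z log W`, `(D exp)_Y(YZ − ZY) = e^YZ − Ze^Y`.  §3 **`eq3114`** = (3.114) for every
background, `λ`, `L`-bond; `eq3114_zd` — `= (D¹_{Ū}Q′λ)(c)` on `Lℤᵈ ≅ ℤᵈ`.  §4 **`eq3115`** = (3.115) for every `j`;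
`eq3115_of_prop2` — loop hypotheses DISCHARGED in the regime of [5] Prop. 2 (`B7AvgGaugeCovariance.Wcx_avgIter_lt_one`);
**`linCovIter_gauge_of_null`** — `Q_j(A − Dλ)(c) = Q_j(A)(c)` whenever `(Q′_jλ)(c₋) = (Q′_jλ)(c₊) = 0`.
PROOF ROUTE (deviation from print, recorded).  Print linearises the GROUP identity `Ū′_c = (R̄u)(c₋)R̄_c(R̄u)⁻¹(c₊)`; a Fréchet
"linear part" in the configuration is not available on the carrier (`Site d → Fin d → 𝔸` is not normed), so the file
linearises print's two displayed group identities SEPARATELY (§1 frames, §2 tilde part) and assembles them through the tree's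
closed form (120)/(122) (`linQcov_eq`) — the same mechanism, organised along [5] (120).  No new definition, no named fact.
NOT DONE HERE.  (3.113) as a non-linear identity; (3.116)–(3.117) (row B9.Eq3.116, `B9Eq3117Current`).

v3 (MERGE, G.5-33(ii), seat p05 = R10 seat of record and merge owner; 2026-08-21).  This path received three Phase-2
filings for row B9.Eq3.113: p12 p243214 (ACCEPTED, then replaced at the head), p15 p243200 (ACCEPTED = the text above
and §§1–4 below, kept VERBATIM), p05 p243343 (BOUNCED on `dedup.landed` against p06's `B9Eq3113Proof` p243218, which
landed the non-linear half).  Per the lead's ruling this version is the UNION, append-only, nothing of the head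
deleted: §§1–4 = p15 (unit `lit-balaban-p15`); §P12 = p12's p243214 theorems restored verbatim in the sub-namespace
`P12` (unit `lit-balaban-p12`: the zero-velocity-residual route to (3.114), `linQcov_covU`, and (3.115)
`linCovIter_covU`/`_of_prop2` over its own `covU`/`Qp`/`QpIter`); §P05 = p05 (unit `lit-balaban-p05`): the
identification of print's `R̄u` with [5] (78) `B7Eq99Concrete.R0avg` (`wframe_pureGauge_R0avg`,
`dbavgCov_pureGauge_R0avg`, `log X⁻¹ = −log X`), (3.114) along print's literal order
(`hasDerivAt_mlog_dbavgCov_expGauge`), the knitting `eq3114` ↔ `B9Eq3113Proof.hasDerivAt_mlog_dbavgCov_uexp`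
(`linQcov_covD_eq_deriv_pureGauge`), and the dictionary `covDerivFwd 1 = B9Eq3169Mu.cod` (`eq3114_cod`).  New imports:
`B9Eq3113Proof` (p06), `B7Eq99Concrete`, `B9Eq3169Mu`.
-/

noncomputable section

open scoped BigOperators
open NormedSpace Finset

namespace Literature.MathematicalPhysics.QuantumFieldTheory.Balaban1983to89.B9Eq3114Proof

open B7Prop1Explicit B7Prop2Explicit B7Prop3Flat B7Eq92Concrete MatrixLog B7Prop3GeneralRotated B7Prop3GeneralLinear
  B7Prop3GeneralTild B7Prop4GeneralLevels B7AvgGaugeCovariance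
open B7Eq78Linearization (conjR conjR_apply conjR_add conjR_sub conjR_smul conjR_smul_real conjR_one Qprime Qprime_apply
  QprimeIter QprimeIter_zero QprimeIter_succ zdBlocking hasDerivAt_exp_smul_zero)
open B12AverageCorridor267 (Dmlog Dexp hasFDerivAt_mlog hasFDerivAt_exp_Dexp PhiY PhiY_apply)
open B8Ineq132 (covDerivFwd conjR_conjR one_conjR)
open B8Eq119TwistedAxial (bgT blockBase_eq_smul)
open Literature.MathematicalPhysics.QuantumLattice (blockBase blockSites)
open Literature.Analysis.Complex (logSeriesCoeff logOnePlus)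

export B7Prop1Explicit (Site) -- the `ℤ^d` sites of the b07 lineage (not the torus sites of `Setup.lean`)

variable {d : ℕ}
variable {𝔸 : Type*} [NormedRing 𝔸] [NormedAlgebra ℂ 𝔸] [NormOneClass 𝔸] [CompleteSpace 𝔸]

/-! ## §1 The covariant difference `Dλ` (p. 390) along lattice words: telescoping, and the frame exponent at `A = Dλ` -/

section Telescoping

omit [NormOneClass 𝔸] [CompleteSpace 𝔸] in
/-- [folklore] unfolding of the tree's forward covariant derivative at `η = 1`:
`(D¹_Vλ)(x, μ) = R(V(x, x+e_μ))λ(x+e_μ) − λ(x)`. -/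
private theorem covDerivFwd_one (V : Site d → Fin d → 𝔸ˣ) (μ : Fin d) (lam : Site d → 𝔸) (x : Site d) :
    covDerivFwd 1 V μ lam x = conjR (V x μ) (lam (x + e μ)) - lam x := by
  simp [covDerivFwd]

omit [NormedAlgebra ℂ 𝔸] [NormOneClass 𝔸] [CompleteSpace 𝔸] in
/-- [folklore] `conjR X 0 = 0`. -/
private theorem conjR_zero (X : 𝔸ˣ) : conjR X (0 : 𝔸) = 0 := by
  simp [conjR_apply]

omit [NormedAlgebra ℂ 𝔸] [NormOneClass 𝔸] [CompleteSpace 𝔸] in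
/-- [folklore] one letter of `(R_{0,y}Dλ)(Γ)`: forwards `R(V(b))λ(b₊) − λ(b₋)`, backwards `R(V(b)⁻¹)λ(b₋) − λ(b₊)` — in
both cases `R(V(letter))λ(end) − λ(start)`. -/
private theorem tstep_covD [NormedAlgebra ℂ 𝔸] (V : Site d → Fin d → 𝔸ˣ) (lam : Site d → 𝔸) (x : Site d)
    (l : Letter d) :
    tstep V (fun z μ => covDerivFwd 1 V μ lam z) x l = conjR (stepHol V x l) (lam (x + l.vec)) - lam x := by
  obtain ⟨μ, b⟩ := l
  cases b
  · simp only [tstep, stepHol, Bool.false_eq_true, ↓reduceIte, Letter.vec_false, covDerivFwd_one, conjR_sub,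
      conjR_conjR, inv_mul_cancel, one_conjR, neg_add_cancel_right, neg_sub]
  · simp only [tstep, stepHol, ↓reduceIte, Letter.vec_true, covDerivFwd_one]

omit [NormOneClass 𝔸] [CompleteSpace 𝔸] in
/-- **TELESCOPING of the transported sum of a covariant difference** along every lattice word `Γ` from `y`:
`(R_{0,y}D_Vλ)(Γ) = R(V(Γ))λ(y + Γ) − λ(y)` — the linear shadow of `(R_yU′)(Γ_{y,x}) = u(y)R(U(Γ_{y,x}))u⁻¹(x)` for the pure
gauge `U′ = 1^u` (p. 418, first display after (3.113)). [cite: Balaban1985BackgroundPropagators, p.418 (before (3.114))] -/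
theorem tsum_covD (V : Site d → Fin d → 𝔸ˣ) (lam : Site d → 𝔸) :
    ∀ (y : Site d) (w : List (Letter d)),
      tsum V (fun z μ => covDerivFwd 1 V μ lam z) y w = conjR (hol V y w) (lam (y + disp w)) - lam y
  | y, [] => by simp [one_conjR]
  | y, l :: w => by
    rw [tsum_cons, tstep_covD, tsum_covD V lam (y + l.vec) w, conjR_sub, conjR_conjR, hol_cons, disp_cons, add_assoc]
    abel

omit [NormOneClass 𝔸] [CompleteSpace 𝔸] in
/-- **THE FRAME EXPONENT AT `A = Dλ`** ((112) of [5] / the exponent of (3.113)): `F̂_V(D_Vλ)(y) = (Q′(V)λ)(y) − λ(y)`,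
`(Q′(V)λ)(y) = Σ_{x∈B(y)} L^{−d}R(V(Γ_{y,x}))λ(x)` — the linear part of print's `R_yU′‾ = u(y)(R̄u)⁻¹(y)` for
`u = e^{iλ}` (telescoping along each `Γ_{y,x}` and `Σ_{x∈B(y)} L^{−d} = 1`). [cite: Balaban1985BackgroundPropagators, (3.113)–(3.114) p.418] -/
theorem FhatCov_covD (L : ℕ) (hL : 1 ≤ L) (V : Site d → Fin d → 𝔸ˣ) (lam : Site d → 𝔸) (y : Site d) :
    FhatCov L V (fun z μ => covDerivFwd 1 V μ lam z) y
      = ∑ r : Fin d → Fin L, (((L : ℝ) ^ d)⁻¹) • conjR (hol V y (treeWord (boxVec L r))) (lam (y + boxVec L r))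
        - lam y := by
  unfold FhatCov
  simp only [tsum_covD, disp_treeWord, smul_sub, Finset.sum_sub_distrib]
  rw [← Finset.sum_smul, sum_weights L hL, one_smul]

end Telescoping

/-! ## §2 The tilde part (119) of [5] at `A = Dλ`: two commutator identities and `(Q′(V)Dλ)_c = R̄_cλ(c₊) − λ(c₋)` -/

section Tilde

omit [NormOneClass 𝔸] in
/-- [folklore] conjugation equivariance of the series logarithm (21) by an ARBITRARY unit, inside its disc:
`log(uWu⁻¹) = u(log W)u⁻¹` (termwise conjugation of the series; no norm condition on `u`). -/
private theorem mlog_conj {W : 𝔸} (hW : ‖W - 1‖ < 1) (u : 𝔸ˣ) :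
    mlog ((u : 𝔸) * W * ((u⁻¹ : 𝔸ˣ) : 𝔸)) = (u : 𝔸) * mlog W * ((u⁻¹ : 𝔸ˣ) : 𝔸) := by
  have hc : (u : 𝔸) * W * ((u⁻¹ : 𝔸ˣ) : 𝔸) - 1 = (u : 𝔸) * (W - 1) * ((u⁻¹ : 𝔸ˣ) : 𝔸) := by
    rw [mul_sub, sub_mul, mul_one, Units.mul_inv]
  have h2 := ((hasSum_mlog hW).mul_left (u : 𝔸)).mul_right ((u⁻¹ : 𝔸ˣ) : 𝔸)
  have h3 : (fun n : ℕ => (u : 𝔸) * (logSeriesCoeff n • (W - 1) ^ n) * ((u⁻¹ : 𝔸ˣ) : 𝔸))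
      = fun n : ℕ => logSeriesCoeff n • ((u : 𝔸) * W * ((u⁻¹ : 𝔸ˣ) : 𝔸) - 1) ^ n := by
    funext n
    rw [hc, Units.conj_pow, mul_smul_comm, smul_mul_assoc]
  rw [h3] at h2
  exact (mlog_def _).trans h2.tsum_eq

omit [NormOneClass 𝔸] [CompleteSpace 𝔸] in
/-- [folklore] the conjugating curve `t ↦ e^{−tZ}Xe^{tZ}` passes through `X` at `t = 0` … -/
private theorem conjCurve_zero (X Z : 𝔸) : exp ((0 : ℂ) • (-Z)) * X * exp ((0 : ℂ) • Z) = X := by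
  simp only [zero_smul, exp_zero, mul_one, one_mul]
omit [NormOneClass 𝔸] in
/-- [folklore] … with velocity `XZ − ZX` there. -/
private theorem hasDerivAt_conjCurve (X Z : 𝔸) :
    HasDerivAt (fun t : ℂ => exp (t • (-Z)) * X * exp (t • Z)) (X * Z - Z * X) 0 := by
  have h := ((hasDerivAt_exp_smul_zero (-Z)).mul_const X).fun_mul (hasDerivAt_exp_smul_zero Z)
  refine h.congr_deriv ?_
  simp only [zero_smul, exp_zero, mul_one, one_mul, neg_mul]
  abel

omit [NormOneClass 𝔸] in
/-- [folklore] the Fréchet derivative of the series logarithm on a commutator direction: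
`(D log)_W(WZ − ZW) = (log W)Z − Z(log W)` for `‖W − 1‖ < 1` (differentiate `log(e^{−tZ}We^{tZ}) = e^{−tZ}(log W)e^{tZ}`
at `t = 0`; uniqueness of the derivative). -/
private theorem Dmlog_apply_comm {W : 𝔸} (hW : ‖W - 1‖ < 1) (Z : 𝔸) :
    Dmlog W (W * Z - Z * W) = mlog W * Z - Z * mlog W := by
  have hlog : ∀ t : ℂ, mlog (exp (t • (-Z)) * W * exp (t • Z)) = exp (t • (-Z)) * mlog W * exp (t • Z) := by
    intro t
    have h := mlog_conj hW (expUnit (t • (-Z)))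
    rw [val_inv_expUnit, val_expUnit, val_expUnit, smul_neg, neg_neg] at h
    simpa only [smul_neg] using h
  have hA : HasDerivAt (fun t : ℂ => mlog (exp (t • (-Z)) * W * exp (t • Z))) (mlog W * Z - Z * mlog W) 0 := by
    simp_rw [hlog]
    exact hasDerivAt_conjCurve (mlog W) Z
  exact ((hasFDerivAt_mlog hW).comp_hasDerivAt_of_eq 0 (hasDerivAt_conjCurve W Z) (conjCurve_zero W Z).symm).unique hA

/-- [folklore] the Fréchet derivative of the exponential on a commutator direction: `(D exp)_Y(YZ − ZY) = e^YZ − Ze^Y`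
(differentiate `exp(e^{−tZ}Ye^{tZ}) = e^{−tZ}e^Ye^{tZ}` at `t = 0`). -/
private theorem Dexp_apply_comm (Y Z : 𝔸) : Dexp Y (Y * Z - Z * Y) = exp Y * Z - Z * exp Y := by
  letI : NormedAlgebra ℚ 𝔸 := NormedAlgebra.restrictScalars ℚ ℂ 𝔸
  have hexp : ∀ t : ℂ, exp (exp (t • (-Z)) * Y * exp (t • Z)) = exp (t • (-Z)) * exp Y * exp (t • Z) := by
    intro t
    have h := exp_units_conj (expUnit (t • (-Z))) Y
    rw [val_inv_expUnit, val_expUnit, val_expUnit, smul_neg, neg_neg] at h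
    simpa only [smul_neg] using h
  have hA : HasDerivAt (fun t : ℂ => exp (exp (t • (-Z)) * Y * exp (t • Z))) (exp Y * Z - Z * exp Y) 0 := by
    simp_rw [hexp]
    exact hasDerivAt_conjCurve (exp Y) Z
  exact ((hasFDerivAt_exp_Dexp Y).comp_hasDerivAt_of_eq 0 (hasDerivAt_conjCurve Y Z) (conjCurve_zero Y Z).symm).unique hA

variable (L : ℕ)

omit [NormOneClass 𝔸] [CompleteSpace 𝔸] in
/-- (114)/(115) of [5] at `A = Dλ`: along the CLOSED block loop `Γ_{c,x} ∪ (−c)` the transported sum of `D_Vλ` is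
`R(W_x)λ(c₋) − λ(c₋)`, `W_x = V(Γ_{c,x} ∪ (−c))` (`tsum_covD` on a closed word). [cite: Balaban1985BackgroundPropagators, (3.113)–(3.114) p.418] -/
theorem Aloop_covD (V : Site d → Fin d → 𝔸ˣ) (lam : Site d → 𝔸) (q : Site d) (κ : Fin d) (r : Site d) :
    Aloop L V (fun z μ => covDerivFwd 1 V μ lam z) q κ r = conjR (Wcx L V q κ r) (lam q) - lam q := by
  rw [Aloop, tsum_covD, Wcx_eq_hol_loop, disp_append, disp_gammaWord, disp_seg, ← add_smul, add_neg_cancel, zero_smul,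
    add_zero]

omit [NormOneClass 𝔸] in
/-- (117) of [5] at `A = Dλ`: the first-order term of the exponent `X_c` is the COMMUTATOR `X_c(V)λ(c₋) − λ(c₋)X_c(V)`
(each loop contributes `(D log)_{W_x}(W_xλ − λW_x) = (log W_x)λ − λ(log W_x)`), under `‖W_x(V) − 1‖ < 1` on `B(c₋)`.
[cite: Balaban1985BackgroundPropagators, (3.113)–(3.114) p.418] -/
theorem DXavg_covD (V : Site d → Fin d → 𝔸ˣ) (lam : Site d → 𝔸) (q : Site d) (κ : Fin d)
    (hW : ∀ r : Fin d → Fin L, ‖((Wcx L V q κ (boxVec L r) : 𝔸ˣ) : 𝔸) - 1‖ < 1) :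
    DXavg L V (fun z μ => covDerivFwd 1 V μ lam z) q κ = Xavg L V q κ * lam q - lam q * Xavg L V q κ := by
  unfold DXavg Xavg
  rw [Finset.sum_mul, Finset.mul_sum, ← Finset.sum_sub_distrib]
  refine Finset.sum_congr rfl fun r _ => ?_
  have hprod : Aloop L V (fun z μ => covDerivFwd 1 V μ lam z) q κ (boxVec L r) * ((Wcx L V q κ (boxVec L r) : 𝔸ˣ) : 𝔸)
      = ((Wcx L V q κ (boxVec L r) : 𝔸ˣ) : 𝔸) * lam q - lam q * ((Wcx L V q κ (boxVec L r) : 𝔸ˣ) : 𝔸) := by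
    rw [Aloop_covD, conjR_apply, sub_mul, Units.inv_mul_cancel_right]
  rw [hprod, Dmlog_apply_comm (hW r), smul_sub, smul_mul_assoc, mul_smul_comm]

/-- **THE TILDE PART AT `A = Dλ`** ((119) of [5]): `(Q′(V)D_Vλ)_c = R̄_cλ(c₊) − λ(c₋)`, `R̄_c = R(V̄_c)` — the linear part of
print's `(U′U)‾_c(Ū_c)⁻¹ = u(c₋)R̄_cu⁻¹(c₊)` for `u = e^{iλ}`, under `‖W_x(V) − 1‖ < 1` on `B(c₋)`.
[cite: Balaban1985BackgroundPropagators, (3.113)–(3.114) p.418] -/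
theorem QprimeCov_covD (V : Site d → Fin d → 𝔸ˣ) (lam : Site d → 𝔸) (q : Site d) (κ : Fin d)
    (hW : ∀ r : Fin d → Fin L, ‖((Wcx L V q κ (boxVec L r) : 𝔸ˣ) : 𝔸) - 1‖ < 1) :
    QprimeCov L V (fun z μ => covDerivFwd 1 V μ lam z) q κ
      = conjR (bavg L V q κ) (lam (q + (L : ℤ) • e κ)) - lam q := by
  have hseg : tsum V (fun z μ => covDerivFwd 1 V μ lam z) q (seg κ L)
      = conjR (hol V q (seg κ L)) (lam (q + (L : ℤ) • e κ)) - lam q := by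
    rw [tsum_covD, disp_seg]
  have hone : exp (Xavg L V q κ) * exp (-Xavg L V q κ) = 1 := by
    rw [← val_expUnit, ← val_expUnit, ← val_inv_expUnit, Units.mul_inv]
  have hphi : PhiY (Xavg L V q κ) (Xavg L V q κ * lam q - lam q * Xavg L V q κ)
      = conjR (expUnit (Xavg L V q κ)) (lam q) - lam q := by
    rw [PhiY_apply, Dexp_apply_comm, sub_mul, mul_assoc (lam q), hone, mul_one, conjR_apply, val_inv_expUnit,
      val_expUnit, val_expUnit]
  rw [QprimeCov, DXavg_covD L V lam q κ hW, hphi, hseg, conjR_sub, conjR_conjR,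
    show expUnit (Xavg L V q κ) * hol V q (seg κ L) = bavg L V q κ from rfl]
  abel

end Tilde

/-! ## §3 (3.114): `(QD^{L⁻¹}λ)(c) = R̄_c(Q′λ)(c₊) − (Q′λ)(c₋) = (D_ŪQ′λ)(c)` -/

section Eq3114

variable (L : ℕ)

/-- **(3.114)** p. 418: *"(QD^{L⁻¹}λ)(c) = R̄_c(Q′λ)(c₊) − (Q′λ)(c₋) = (D_ŪQ′λ)(c)"* — for the paper's one-step LINEAR
averaging operator `Q(V)` ((3.14)–(3.15): the linear part of (3.13), `linQcov L V` = `L·(Q(V)·)_c`, so that with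
`D^{L⁻¹} = L·D¹` the left side is `linQcov L V (D¹_Vλ) c`), the block mean with parallel transport (3.18)
`(Q′(V)λ)(y) = Σ_{x∈B(y)} L^{−d}R(V(Γ_{y,x}))λ(x)` and `R̄_c = R(V̄_c)`: an EXACT identity at every background `V` whose block
loops lie in the disc of the logarithm (`‖V(Γ_{c,x}∪(−c)) − 1‖ < 1`, `x ∈ B(c₋)`), every `λ`, every `L`-bond `c = ⟨q, q + Le_κ⟩`
of `ℤᵈ`. [cite: Balaban1985BackgroundPropagators, (3.114) p.418] -/
theorem eq3114 (hL : 1 ≤ L) (V : Site d → Fin d → 𝔸ˣ) (lam : Site d → 𝔸) (q : Site d) (κ : Fin d)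
    (hW : ∀ r : Fin d → Fin L, ‖((Wcx L V q κ (boxVec L r) : 𝔸ˣ) : 𝔸) - 1‖ < 1) :
    linQcov L V (fun z μ => covDerivFwd 1 V μ lam z) q κ
      = conjR (bavg L V q κ)
          (∑ r : Fin d → Fin L, (((L : ℝ) ^ d)⁻¹) •
            conjR (hol V (q + (L : ℤ) • e κ) (treeWord (boxVec L r))) (lam (q + (L : ℤ) • e κ + boxVec L r)))
        - ∑ r : Fin d → Fin L, (((L : ℝ) ^ d)⁻¹) • conjR (hol V q (treeWord (boxVec L r))) (lam (q + boxVec L r)) := by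
  rw [linQcov_eq L V _ q κ hW, FhatCov_covD L hL, FhatCov_covD L hL, QprimeCov_covD L V lam q κ hW, conjR_sub]
  abel

/-- [folklore] a sum over the block `blockSites L y = {Ly + t : t ∈ [0,L)ᵈ}` of the scaled coordinates is the sum over
the corner-block offsets `boxVec L r`, `r : Fin d → Fin L`, of the b07 lineage. -/
private theorem sum_blockSites_eq_sum_boxVec {β : Type*} [AddCommMonoid β] (y : Site d) (F : Site d → β) :
    ∑ x ∈ blockSites L y, F x = ∑ r : Fin d → Fin L, F (blockBase L y + boxVec L r) := by
  classical
  unfold blockSites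
  rw [Finset.sum_image]
  · refine Finset.sum_bij' (fun t ht => fun k => ⟨t k, ?_⟩) (fun r _ => fun k => ((r k : ℕ)))
      (fun _ _ => Finset.mem_univ _) (fun r _ => ?_) (fun _ _ => rfl) (fun _ _ => rfl) (fun _ _ => rfl)
    · exact Finset.mem_range.1 ((Fintype.mem_piFinset.1 ht) k)
    · exact Fintype.mem_piFinset.2 fun k => Finset.mem_range.2 (r k).isLt
  · intro t _ t' _ h
    funext i
    simpa using congr_fun h i

omit [NormOneClass 𝔸] in
/-- **(3.18) on the blocks of `Lℤᵈ ≅ ℤᵈ`**: the tree's `Q′` (`B7Eq78Linearization.Qprime`) on `blockSites L y` with weights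
`L^{−d}` and the background transporters `bgT L V j y x = V̄ʲ(Γ_{Ly,x})` (`B8Eq119TwistedAxial.bgT`) IS the block mean
with parallel transport `Σ_{x∈B(Ly)} L^{−d}R(V̄ʲ(Γ_{Ly,x}))μ(x)` of the b07 carrier. [cite: Balaban1985BackgroundPropagators, (3.18)–(3.19) p.393] -/
theorem Qprime_bgT (V : Site d → Fin d → 𝔸ˣ) (j : ℕ) (μ : Site d → 𝔸) (y : Site d) :
    Qprime (blockSites L y) (fun _ => ((L : ℝ) ^ d)⁻¹) (bgT L V j y) μ
      = ∑ r : Fin d → Fin L, (((L : ℝ) ^ d)⁻¹) •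
          conjR (hol (avgIter L V j) ((L : ℤ) • y) (treeWord (boxVec L r))) (μ ((L : ℤ) • y + boxVec L r)) := by
  rw [Qprime_apply, sum_blockSites_eq_sum_boxVec, blockBase_eq_smul]
  refine Finset.sum_congr rfl fun r _ => ?_
  simp only [bgT, axialFn, blockBase_eq_smul, add_sub_cancel_left]

omit [NormOneClass 𝔸] in
/-- **(3.19) one more level, unfolded**: `(Q′_{j+1}μ)(y) = Σ_{x∈B(Ly)} L^{−d}R(V̄ʲ(Γ_{Ly,x}))(Q′_jμ)(x)` for the tree's
`QprimeIter (zdBlocking d L) (bgT L V)`. [cite: Balaban1985BackgroundPropagators, (3.19) p.393] -/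
theorem QprimeIter_bgT_succ (V : Site d → Fin d → 𝔸ˣ) (j : ℕ) (μ : Site d → 𝔸) (y : Site d) :
    QprimeIter (zdBlocking d L) (bgT L V) (j + 1) μ y
      = ∑ r : Fin d → Fin L, (((L : ℝ) ^ d)⁻¹) •
          conjR (hol (avgIter L V j) ((L : ℤ) • y) (treeWord (boxVec L r)))
            (QprimeIter (zdBlocking d L) (bgT L V) j μ ((L : ℤ) • y + boxVec L r)) := by
  rw [QprimeIter_succ]
  exact Qprime_bgT L V j _ y

/-- **(3.114), second equality, on the coarse lattice `Lℤᵈ ≅ ℤᵈ`**: `(QD^{L⁻¹}λ)(c) = (D_{V̄}Q′λ)(c)` for the `L`-bond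
`c = ⟨Ly, L(y + e_κ)⟩`, with `V̄ = avgIter L V 1` ((42)/(43) of [5]) and `Q′ = Q′_1 = QprimeIter (zdBlocking d L) (bgT L V) 1`
((3.18)–(3.19)), under the loop condition on `B(c₋)`. [cite: Balaban1985BackgroundPropagators, (3.114) p.418] -/
theorem eq3114_zd (hL : 1 ≤ L) (V : Site d → Fin d → 𝔸ˣ) (lam : Site d → 𝔸) (y : Site d) (κ : Fin d)
    (hW : ∀ r : Fin d → Fin L, ‖((Wcx L V ((L : ℤ) • y) κ (boxVec L r) : 𝔸ˣ) : 𝔸) - 1‖ < 1) :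
    linQcov L V (fun z μ => covDerivFwd 1 V μ lam z) ((L : ℤ) • y) κ
      = covDerivFwd 1 (avgIter L V 1) κ (QprimeIter (zdBlocking d L) (bgT L V) 1 lam) y := by
  rw [eq3114 L hL V lam _ κ hW, covDerivFwd_one, QprimeIter_bgT_succ, QprimeIter_bgT_succ, QprimeIter_zero, smul_add]
  rfl

end Eq3114

/-! ## §4 (3.115): `Q_jDλ = D̄ʲQ′_jλ`, and the invariance of `Q_jA` under `λ ∈ N(Q′_j)` -/

section Eq3115

variable (L : ℕ)

/-- **(3.115)** p. 418: *"Iterating this identity we obtain finally Q_jDλ = D^{Lʲη}_{Ūʲ}Q′_jλ = D̄ʲQ′_jλ, (3.115) where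
the last equality is a definition of the symbol D̄ʲ"* — for the composite `Q_j(U) = Q(Ūʲ⁻¹)⋯Q(Ū)Q(U)` (3.15) of the
linear one-step operators (`B7Prop4GeneralLevels.linCovIter`, every level read on `ℤᵈ`), `Q′_j` the composite (3.19)
(`QprimeIter (zdBlocking d L) (bgT L U)`), `Ūʲ = avgIter L U j` and `D̄ʲ = D¹_{Ūʲ}` on the level-`j` lattice: an exact
identity for every `j`, every `λ`, every coarse bond, under the loop conditions at the levels `< j`.
[cite: Balaban1985BackgroundPropagators, (3.115) p.418] -/
theorem eq3115 (hL : 1 ≤ L) (U : Site d → Fin d → 𝔸ˣ) (lam : Site d → 𝔸) :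
    ∀ j : ℕ, (∀ i < j, ∀ (z : Site d) (κ : Fin d) (r : Fin d → Fin L),
        ‖((Wcx L (avgIter L U i) ((L : ℤ) • z) κ (boxVec L r) : 𝔸ˣ) : 𝔸) - 1‖ < 1) →
      ∀ (z : Site d) (κ : Fin d),
        linCovIter L U (fun x μ => covDerivFwd 1 U μ lam x) j z κ
          = covDerivFwd 1 (avgIter L U j) κ (QprimeIter (zdBlocking d L) (bgT L U) j lam) z
  | 0, _, z, κ => rfl
  | j + 1, hW, z, κ => by
    have IH : linCovIter L U (fun x μ => covDerivFwd 1 U μ lam x) j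
        = fun x μ => covDerivFwd 1 (avgIter L U j) μ (QprimeIter (zdBlocking d L) (bgT L U) j lam) x :=
      funext fun x => funext fun μ => eq3115 hL U lam j (fun i hi => hW i (Nat.lt_succ_of_lt hi)) x μ
    rw [linCovIter_succ, IH, eq3114_zd L hL (avgIter L U j) _ z κ (hW j (Nat.lt_succ_self j) z κ)]
    rfl

/-- **(3.115) IN THE REGIME OF [5] PROPOSITION 2** — the loop conditions DISCHARGED: for a background `U` with values in a
subgroup `G ⊂ {|u| ≤ 1, |u⁻¹| ≤ 1}` closed under the average, with `sup_p |U(∂p) − 1| < α₀L^{−2k}` ((52) of [5]) and the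
printed smallness of `α₀` (`C₀α₀ ≤ 1/3`, `2α₀ ≤ c₂′`, `L ≥ 2`), every block loop of every `Ūʲ`, `j ≤ k`, lies within the
disc of the logarithm (`B7AvgGaugeCovariance.Wcx_avgIter_lt_one`), hence `Q_jDλ = D̄ʲQ′_jλ` for all `j ≤ k`.
[cite: Balaban1985BackgroundPropagators, (3.115) p.418] -/
theorem eq3115_of_prop2 (hL : 2 ≤ L) {G : Subgroup 𝔸ˣ} (hG : AvgClosed d L G) (k : ℕ)
    (U : Site d → Fin d → 𝔸ˣ) (hU : ∀ x κ, U x κ ∈ G) {α₀ : ℝ} (hα : 0 < α₀) (hα3 : C0 d * α₀ ≤ 1 / 3)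
    (hα2 : 2 * α₀ ≤ c2' d L) (h52 : pdev U < α₀ * (((L : ℝ) ^ k)⁻¹) ^ 2) (lam : Site d → 𝔸) :
    ∀ j ≤ k, ∀ (z : Site d) (κ : Fin d),
      linCovIter L U (fun x μ => covDerivFwd 1 U μ lam x) j z κ
        = covDerivFwd 1 (avgIter L U j) κ (QprimeIter (zdBlocking d L) (bgT L U) j lam) z :=
  fun j hj => eq3115 L (le_trans (by norm_num) hL) U lam j fun i hi z κ r =>
    Wcx_avgIter_lt_one L hL hG k U hU hα hα3 hα2 h52 i (le_trans hi.le hj) _ κ r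

/-- [folklore] the composite linear operator `Q_j` is subtractive in its argument, under the loop conditions at the levels
`< j` (from the one-step additivity/homogeneity `B7Prop3GeneralTild.linQcov_add`/`linQcov_smul`). -/
private theorem linCovIter_sub (U : Site d → Fin d → 𝔸ˣ) (A B : Site d → Fin d → 𝔸) :
    ∀ j : ℕ, (∀ i < j, ∀ (z : Site d) (κ : Fin d) (r : Fin d → Fin L),
        ‖((Wcx L (avgIter L U i) ((L : ℤ) • z) κ (boxVec L r) : 𝔸ˣ) : 𝔸) - 1‖ < 1) →
      ∀ (z : Site d) (κ : Fin d),
        linCovIter L U (fun x μ => A x μ - B x μ) j z κ = linCovIter L U A j z κ - linCovIter L U B j z κ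
  | 0, _, _, _ => rfl
  | j + 1, hW, z, κ => by
    have IH : linCovIter L U (fun x μ => A x μ - B x μ) j
        = linCovIter L U A j + (-1 : ℂ) • linCovIter L U B j := by
      funext x μ
      rw [linCovIter_sub U A B j (fun i hi => hW i (Nat.lt_succ_of_lt hi)) x μ]
      simp only [Pi.add_apply, Pi.neg_apply, neg_one_smul, sub_eq_add_neg]
    have hWj := hW j (Nat.lt_succ_self j) z κ
    rw [linCovIter_succ, linCovIter_succ, linCovIter_succ, IH, linQcov_add L _ _ _ _ κ hWj,
      linQcov_smul L _ _ _ _ κ hWj, neg_one_smul, sub_eq_add_neg]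

/-- **"In particular they imply that the average QA are invariant with respect to gauge transformations λ satisfying
Q′λ = 0, i.e. λ∈N(Q′)"** (p. 418, after (3.115)), at level `j` and bondwise: if `(Q′_jλ)` vanishes at both ends of the
coarse bond `c = ⟨z, z + e_κ⟩`, then `Q_j(A − Dλ)(c) = Q_j(A)(c)` (since `Q_j(A − Dλ) = Q_jA − D̄ʲQ′_jλ` by (3.115)), under
the loop conditions at the levels `< j`. [cite: Balaban1985BackgroundPropagators, p.418 (after (3.115))] -/
theorem linCovIter_gauge_of_null (U : Site d → Fin d → 𝔸ˣ) (A : Site d → Fin d → 𝔸) (lam : Site d → 𝔸) (j : ℕ)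
    (hL : 1 ≤ L)
    (hW : ∀ i < j, ∀ (z : Site d) (κ : Fin d) (r : Fin d → Fin L),
      ‖((Wcx L (avgIter L U i) ((L : ℤ) • z) κ (boxVec L r) : 𝔸ˣ) : 𝔸) - 1‖ < 1)
    (z : Site d) (κ : Fin d) (h0 : QprimeIter (zdBlocking d L) (bgT L U) j lam z = 0)
    (h1 : QprimeIter (zdBlocking d L) (bgT L U) j lam (z + e κ) = 0) :
    linCovIter L U (fun x μ => A x μ - covDerivFwd 1 U μ lam x) j z κ = linCovIter L U A j z κ := by
  rw [linCovIter_sub L U A _ j hW z κ, eq3115 L hL U lam j hW z κ, covDerivFwd_one, h0, h1, conjR_zero, sub_zero,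
    sub_zero]

end Eq3115

end Literature.MathematicalPhysics.QuantumFieldTheory.Balaban1983to89.B9Eq3114Proof

/-! ## §P12 — seat p12's p243214 (ACCEPTED 2026-08-21T00:5xZ, replaced at the head by p243200; restored here VERBATIM per
G.5-33(ii), in the sub-namespace `P12`; author unit `lit-balaban-p12`).  ITS OWN SUMMARY (from its module docstring):
WHAT THIS FILE PROVES (kernel-checked, 0 `sorry`, standard axioms; every `d`, every `L ≥ 1`, every `𝔸`).
§1 `tsum_covU`: the rotated sum `(R_{0,y}D_Uλ)(Γ)` of [5] TELESCOPES to `R(U(Γ))λ(Γ₊) − λ(y)`; `FhatCov_covU`: the frame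
exponent (112) of [5] at `A = D_Uλ` is `Q′(U)λ − λ` (linearisation of "\overline{R_yU′} = u(y)(\overline{Ru})⁻¹(y)").
§2 the pure-gauge factorisation `e^{tD_Uλ} = (M_t)^{v_t}` (moving-frame action (55) of [5], `v_t = e^{−tλ}`), the residual
`M_t` having ZERO velocity at `t = 0` (`hasDerivAt_Mcfg`); the EXACT covariance (93) of [5] `B7Eq92Concrete.tild_mgauge`
("(\overline{U′U})_c(Ū_c)⁻¹ = u(c₋)R̄_cu⁻¹(c₊)") and the zero velocity of `Ṽ₁` along the residual (`hasDerivAt_tild_Mcfg`: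
pushed through the products (9), the series `log` — analytic at the loop variables, `MatrixLog.analyticAt_mlog` — and
`exp`) give the middle factor of (89) the derivative `D = −λ(c₋) + R̄_cλ(c₊)` (`hasDerivAt_tild_expCfg_covU`).
§3 **(3.114)** `linQcov_covU`/`hasDerivAt_Qcov_covU`: under the log-domain condition `‖U(Γ_{c,x}∪(−c)) − 1‖ < 1` on the
block's `L^d` loop variables (`B7Prop1Explicit.Wcx`; implied by [5] (44), `B7Prop2Explicit.norm_Wcx_sub_one_le`),
`linQcov L U (D_Uλ) c = R̄_c(Q′(U)λ)(c₊) − (Q′(U)λ)(c₋)` (frames by `B7Prop3GeneralLinear.hasDerivAt_Qcov_of_tild`,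
telescoped by §1); `linQcov_covU_eq_zero_of_Qp` = the printed invariance sentence for the `QDλ` term.
§4 **(3.115)** `linCovIter_covU`: `linCovIter L U (D_Uλ) j = D_{Ūʲ}(Q′_j(U)λ)` for every `j` (printed iteration), under
the domain condition at the levels `m < j`; `linCovIter_covU_of_prop2`: the condition DISCHARGED for all `j ≤ k` under the
hypotheses of [5] Proposition 2 (`B7AvgGaugeCovariance.Wcx_avgIter_lt_one`, BY NAME).
HONEST SCOPE.  (i) "Linear part" = the lineage's `linQcov`; the print's `(QD^{L⁻¹}λ)` differs from it by the absorbed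
factor `Lη` on BOTH sides of (3.114).  (ii) Additivity «Q_j(A − Dλ) = Q_jA − Q_jDλ» (linearity of the linear part) is NOT
used and NOT certified (cf. `B7Prop3GeneralLinear`, NOT CERTIFIED (iv)); hence no dictionary to the abstract MATRIX
hypotheses `h115 : Q·D = D̄·Q′` of `B9Eq3184` &c. (which presuppose `Q` linear) is made here.  (iii) The non-linear
displays of p. 418 ((3.113), `\overline{R_yU′} = u(y)(\overline{Ru})⁻¹(y)`, `Ū′_c = (\overline{Ru})(c₋)R̄_c(\overline{Ru})⁻¹(c₊)`)
enter through their exact linearisations (§2) — the three factors of (89) are differentiated along the pure-gauge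
curve; the group-level identity (which needs `log X⁻¹ = −log X`, a further smallness window) is not restated.  (iv) The
log-domain hypothesis is the analyticity domain of (121); outside it `linQcov` is a junk `deriv`.  No existing module is
modified; no Prop-valued fact is introduced.
MERGE NOTES (p05).  (a) item (ii) above is superseded: `B7Prop3GeneralTild.linQcov_add`/`linQcov_smul` certify the
additivity/homogeneity of the linear part under the loop condition (used by §4 above, `linCovIter_gauge_of_null`); (b)
the group-level identity of item (iii) is `dbavgCov_pureGauge_R0avg` of §P05 below (smallness window
`‖u⁻¹(y)R(U(Γ_{y,x}))u(x) − 1‖ < ½`); (c) `P12.Qp`/`P12.QpIter`/`P12.covU` are p12's own carriers of (3.19)/p. 390 —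
cf. `B9Eq3113Proof.Qp`/`QpIter`/`Dcov` (p06) and the head's `B8Ineq132.covDerivFwd 1`/`QprimeIter (zdBlocking d L)
(bgT L U)`; all agree pointwise by unfolding (`P12.Qp_eq_Qprime`, `B9Eq3113Proof.Qp_eq_sum`, `P12.covU_apply`,
`B9Eq3113Proof.Dcov_apply`). -/

namespace Literature.MathematicalPhysics.QuantumFieldTheory.Balaban1983to89.B9Eq3114Proof.P12


open B7Prop1Explicit B7Prop2Explicit B7Prop3Flat B7Eq92Concrete B7Prop3GeneralRotated B7Prop3GeneralLinear
  B7Prop4GeneralLevels B7AvgGaugeCovariance MatrixLog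
open B7Eq78Linearization (conjR conjR_apply conjR_one conjR_add conjR_sub conjR_smul_real hasDerivAt_conjR_comp
  hasDerivAt_exp_smul_zero)

export B7Prop1Explicit (Site)

variable {d : ℕ}
variable {𝔸 : Type*} [NormedRing 𝔸] [NormedAlgebra ℂ 𝔸] [CompleteSpace 𝔸]

/-! ## §0 The objects: `D_Uλ` (p. 390), `Q′(V)λ` and `Q′_j(U)λ` (3.19) -/

omit [NormedAlgebra ℂ 𝔸] [CompleteSpace 𝔸] in
/-- **the covariant derivative of a site function** (p. 390, *"(D^η_{U₀}A)(b) = η⁻¹(R(U₀(b))A(b₊) − A(b₋))"*, for the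
site function `λ` of p. 418, `η` absorbed, `R(X)Y = XYX⁻¹`): `(D_Uλ)(⟨x, x + e_μ⟩) = R(U(x, x + e_μ))λ(x + e_μ) − λ(x)`; at
the averaged background `Ūʲ` (read on `ℤ^d`) it is the `D̄ʲ` of (3.115) up to the absorbed factor `Lʲη`.
[cite: Balaban1985BackgroundPropagators, p.390 + (3.114)–(3.115) p.418] -/
def covU (U : Site d → Fin d → 𝔸ˣ) (lam : Site d → 𝔸) : Site d → Fin d → 𝔸 :=
  fun x μ => conjR (U x μ) (lam (x + e μ)) - lam x

omit [NormedAlgebra ℂ 𝔸] [CompleteSpace 𝔸] in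
/-- `covU` unfolded. [cite: Balaban1985BackgroundPropagators, p.390] -/
@[simp] theorem covU_apply (U : Site d → Fin d → 𝔸ˣ) (lam : Site d → 𝔸) (x : Site d) (μ : Fin d) :
    covU U lam x μ = conjR (U x μ) (lam (x + e μ)) - lam x := rfl

omit [CompleteSpace 𝔸] in
/-- **(3.19), one step, with the CONCRETE tree contours**: `(Q′(V)λ)(y) = Σ_{x∈B(y)} L^{−d}R(V(Γ_{y,x}))λ(x)`,
`x = y + r`, `r ∈ [0, L)^d`, `Γ_{y,x} = treeWord r` from `y`. [cite: Balaban1985BackgroundPropagators, (3.19) p.393] -/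
def Qp (L : ℕ) (V : Site d → Fin d → 𝔸ˣ) (lam : Site d → 𝔸) (y : Site d) : 𝔸 :=
  ∑ r : Fin d → Fin L, (((L : ℝ) ^ d)⁻¹) • conjR (hol V y (treeWord (boxVec L r))) (lam (y + boxVec L r))

omit [CompleteSpace 𝔸] in
/-- `Q′(V)` IS the tree's (3.19)-operator `B7Eq78Linearization.Qprime` (block indexed by the offsets `r`, weights `L^{−d}`)
with the transporters SPECIALISED to the tree-contour variables `V(Γ_{y,x})`. [cite: Balaban1985BackgroundPropagators, (3.19) p.393] -/
theorem Qp_eq_Qprime (L : ℕ) (V : Site d → Fin d → 𝔸ˣ) (lam : Site d → 𝔸) (y : Site d) :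
    Qp L V lam y = B7Eq78Linearization.Qprime (Finset.univ : Finset (Fin d → Fin L)) (fun _ => ((L : ℝ) ^ d)⁻¹)
      (fun r => hol V y (treeWord (boxVec L r))) (fun r => lam (y + boxVec L r)) := rfl

/-- **(3.19), `j` steps**: `Q′_j(U) = Q′(Ūʲ⁻¹)·…·Q′(Ū)Q′(U)`, `Q′_0 = id`, each level read on `ℤ^d` exactly as the
averaged backgrounds `Ūʲ = avgIter L U j` are ([5] (43)): `(Q′_{j+1}λ)(z) = (Q′(Ūʲ)(Q′_jλ))(Lz)`.
[cite: Balaban1985BackgroundPropagators, (3.19) p.393] -/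
def QpIter (L : ℕ) (U : Site d → Fin d → 𝔸ˣ) (lam : Site d → 𝔸) : ℕ → Site d → 𝔸
  | 0 => lam
  | j + 1 => fun z => Qp L (avgIter L U j) (QpIter L U lam j) ((L : ℤ) • z)

/-- `Q′_0 = id`. [cite: Balaban1985BackgroundPropagators, (3.19) p.393] -/
@[simp] theorem QpIter_zero (L : ℕ) (U : Site d → Fin d → 𝔸ˣ) (lam : Site d → 𝔸) : QpIter L U lam 0 = lam := rfl

/-- `Q′_{j+1} = Q′(Ūʲ)Q′_j`, read on `ℤ^d`. [cite: Balaban1985BackgroundPropagators, (3.19) p.393] -/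
theorem QpIter_succ (L : ℕ) (U : Site d → Fin d → 𝔸ˣ) (lam : Site d → 𝔸) (j : ℕ) (z : Site d) :
    QpIter L U lam (j + 1) z = Qp L (avgIter L U j) (QpIter L U lam j) ((L : ℤ) • z) := rfl

/-! ## §1 Telescoping of the rotated sums of a covariant derivative; the frame exponent at `A = D_Uλ` -/

omit [NormedAlgebra ℂ 𝔸] [CompleteSpace 𝔸] in
/-- one letter: the rotated contribution of `D_Uλ` along `l` from `y` is `R(U(l))λ(y + l) − λ(y)` (either orientation).
[cite: Balaban1985BackgroundPropagators, p.390 + (3.114) p.418] -/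
theorem tstep_covU (U : Site d → Fin d → 𝔸ˣ) (lam : Site d → 𝔸) (y : Site d) (l : Letter d) :
    tstep U (covU U lam) y l = conjR (stepHol U y l) (lam (y + l.vec)) - lam y := by
  obtain ⟨μ, b⟩ := l
  cases b
  · have hv : Letter.vec ((μ, false) : Letter d) = -e μ := rfl
    simp only [tstep, Bool.false_eq_true, ↓reduceIte, covU_apply, stepHol_false, hv, ← sub_eq_add_neg,
      sub_add_cancel]
    rw [conjR_sub, ← conjR_mul_left, inv_mul_cancel, show conjR (1 : 𝔸ˣ) (lam y) = lam y by simp [conjR_apply]]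
    abel
  · simp [tstep, stepHol]

omit [NormedAlgebra ℂ 𝔸] [CompleteSpace 𝔸] in
/-- **TELESCOPING**: along any word `Γ` from `y`, `(R_{0,y}D_Uλ)(Γ) = R(U(Γ))λ(y + Γ) − λ(y)` (for [5]'s rotated sums
`tsum`; cf. p. 430 *"(R_y(V)(B + D̄μ))(Γ_{y,x}) = (R_y(V)B)(Γ_{y,x}) + R(V(Γ_{y,x}))μ(x) − μ(y)"*).
[cite: Balaban1985BackgroundPropagators, (3.114) p.418 + p.430] -/
theorem tsum_covU (U : Site d → Fin d → 𝔸ˣ) (lam : Site d → 𝔸) :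
    ∀ (y : Site d) (w : List (Letter d)),
      tsum U (covU U lam) y w = conjR (hol U y w) (lam (y + disp w)) - lam y
  | y, [] => by simp [conjR_apply]
  | y, l :: w => by
    rw [tsum_cons, tsum_covU U lam (y + l.vec) w, tstep_covU, hol_cons, conjR_mul_left, disp_cons, conjR_sub,
      add_assoc y]
    abel

omit [CompleteSpace 𝔸] in
/-- **the frame exponent (112) of [5] at `A = D_Uλ` is `Q′(U)λ − λ`**: `F̂_U(D_Uλ)(y) = Σ_{x∈B(y)} L^{−d}[R(U(Γ_{y,x}))λ(x)
− λ(y)] = (Q′(U)λ)(y) − λ(y)` (the weights sum to `1`) — the linearisation of *"\overline{R_yU′} = u(y)(\overline{Ru})⁻¹(y)"*.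
[cite: Balaban1985BackgroundPropagators, (3.113)–(3.114) p.418] -/
theorem FhatCov_covU (L : ℕ) (hL : 1 ≤ L) (U : Site d → Fin d → 𝔸ˣ) (lam : Site d → 𝔸) (y : Site d) :
    FhatCov L U (covU U lam) y = Qp L U lam y - lam y := by
  unfold FhatCov Qp
  simp_rw [tsum_covU, disp_treeWord, smul_sub]
  rw [Finset.sum_sub_distrib, ← Finset.sum_smul, sum_weights L hL, one_smul]

/-! ## §2 The pure-gauge curve of p. 418 and its second-order residual; the derivative of `Ṽ₁` along `e^{tD_Uλ}` -/

/-- the pure-gauge site function `v_t = e^{−tλ}` (print: `u = e^{iλ}`; sign and `i` absorbed so that the pure gauge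
`U′(x, x′) = u(x)R(U(x, x′))u⁻¹(x′)` has linear part `+D_Uλ` — print's *"A^λ = A − Dλ"*, p. 393).
[cite: Balaban1985BackgroundPropagators, p.418 + p.393] -/
def vcfg (lam : Site d → 𝔸) (t : ℂ) : Site d → 𝔸ˣ := fun x => expUnit (-(t • lam x))

/-- the residual `M_t := (e^{tD_Uλ})^{v_t⁻¹}` (the configuration the pure gauge `v_t` moves to `e^{tD_Uλ}`); every bond
variable of `M_t` is `1 + O(t²)` (`hasDerivAt_Mcfg`). [cite: Balaban1985BackgroundPropagators, p.418 + p.393] -/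
def Mcfg (U : Site d → Fin d → 𝔸ˣ) (lam : Site d → 𝔸) (t : ℂ) : Site d → Fin d → 𝔸ˣ :=
  mgauge U (fun x => expUnit (t • lam x)) (expCfg (t • covU U lam))

/-- **the factorisation**: `e^{tD_Uλ} = (M_t)^{v_t}` bondwise (the pure gauge of p. 418 written relative to the ray
`e^{tD_Uλ}` through the moving-frame action (55) of [5]). [cite: Balaban1985BackgroundPropagators, p.418] -/
theorem expCfg_covU_eq_mgauge (U : Site d → Fin d → 𝔸ˣ) (lam : Site d → 𝔸) (t : ℂ) :
    expCfg (t • covU U lam) = mgauge U (vcfg lam t) (Mcfg U lam t) := by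
  funext x κ
  simp only [Mcfg, vcfg, mgauge_apply, ← val_inv_expUnit, map_inv, inv_inv]
  group

/-- `M_0 = 1`. [cite: Balaban1985BackgroundPropagators, p.418] -/
theorem Mcfg_zero (U : Site d → Fin d → 𝔸ˣ) (lam : Site d → 𝔸) : Mcfg U lam 0 = 1 := by
  have h0 : expUnit (0 : 𝔸) = (1 : 𝔸ˣ) := Units.ext (by simp)
  funext x κ
  simp only [Mcfg, mgauge_apply, zero_smul, expCfg_zero, Pi.one_apply, h0, map_one, inv_one, mul_one]

/-- **the residual is second order**: every bond variable `M_t(b) = e^{tλ(b₋)}e^{t(D_Uλ)(b)}R(U(b))e^{−tλ(b₊)}` has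
`t`-derivative `λ(b₋) + (R(U(b))λ(b₊) − λ(b₋)) − R(U(b))λ(b₊) = 0` at `t = 0` — *"a linear gauge transformation defined
by λ is a linear part of the transformation U′ → U′^u defined by u = e^{iλ}"*. [cite: Balaban1985BackgroundPropagators, p.418 + p.393] -/
theorem hasDerivAt_Mcfg (U : Site d → Fin d → 𝔸ˣ) (lam : Site d → 𝔸) (x : Site d) (μ : Fin d) :
    HasDerivAt (fun t : ℂ => ((Mcfg U lam t x μ : 𝔸ˣ) : 𝔸)) 0 0 := by
  have hval : ∀ t : ℂ, ((Mcfg U lam t x μ : 𝔸ˣ) : 𝔸)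
      = exp (t • lam x) * exp (t • covU U lam x μ)
          * (((U x μ : 𝔸ˣ) : 𝔸) * exp (t • (-lam (x + e μ))) * (((U x μ)⁻¹ : 𝔸ˣ) : 𝔸)) := by
    intro t
    rw [Mcfg, mgauge_apply, ← map_inv, val_inv_expUnit]
    simp only [expCfg, Pi.smul_apply, Rc_apply, Units.val_mul, val_expUnit, smul_neg]
  simp_rw [hval]
  have h1 := hasDerivAt_exp_smul_zero (lam x)
  have h2 := hasDerivAt_exp_smul_zero (covU U lam x μ)
  have h3 := ((hasDerivAt_exp_smul_zero (-lam (x + e μ))).const_mul (((U x μ : 𝔸ˣ) : 𝔸))).mul_const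
    ((((U x μ)⁻¹ : 𝔸ˣ) : 𝔸))
  have h := (h1.fun_mul h2).fun_mul h3
  refine h.congr_deriv ?_
  simp only [zero_smul, exp_zero, mul_one, one_mul, Units.mul_inv, covU_apply, conjR_apply, mul_neg, neg_mul]
  abel

/-! ### zero velocity propagates through the one-step average (42) -/

/-- [folklore] the inverse of a unit-valued curve with zero velocity has zero velocity (`Ring.inverse`, differentiable at
units). -/
private theorem hasDerivAt_val_inv_zero {γ : ℂ → 𝔸ˣ}
    (h : HasDerivAt (fun t => ((γ t : 𝔸ˣ) : 𝔸)) 0 0) :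
    HasDerivAt (fun t => (((γ t)⁻¹ : 𝔸ˣ) : 𝔸)) 0 0 := by
  have h' := (hasFDerivAt_ringInverse (𝕜 := ℂ) (γ 0)).comp_hasDerivAt 0 h
  simpa [Function.comp_def, Ring.inverse_unit] using h'

omit [CompleteSpace 𝔸] in
/-- [folklore] the product of two curves with zero velocity has zero velocity. -/
private theorem hasDerivAt_mul_zero {f g : ℂ → 𝔸} (hf : HasDerivAt f 0 0) (hg : HasDerivAt g 0 0) :
    HasDerivAt (fun t => f t * g t) 0 0 := by
  simpa using hf.fun_mul hg

/-- every bond variable of `M_t·U`, in either orientation, has zero velocity at `t = 0`. [cite: Balaban1985BackgroundPropagators, p.418] -/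
theorem hasDerivAt_stepHol_Mcfg (U : Site d → Fin d → 𝔸ˣ) (lam : Site d → 𝔸) (x : Site d) (l : Letter d) :
    HasDerivAt (fun t : ℂ => ((stepHol (Mcfg U lam t * U) x l : 𝔸ˣ) : 𝔸)) 0 0 := by
  obtain ⟨μ, b⟩ := l
  have hpos : ∀ y : Site d,
      HasDerivAt (fun t : ℂ => (((Mcfg U lam t * U) y μ : 𝔸ˣ) : 𝔸)) 0 0 := fun y => by
    simpa [Pi.mul_apply] using (hasDerivAt_Mcfg U lam y μ).mul_const (((U y μ : 𝔸ˣ) : 𝔸))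
  cases b
  · simpa [stepHol_false] using hasDerivAt_val_inv_zero (hpos (x - e μ))
  · simpa [stepHol_true] using hpos x

/-- … hence so has every contour variable `(M_t·U)(Γ)`. [cite: Balaban1985BackgroundPropagators, p.418] -/
theorem hasDerivAt_hol_Mcfg (U : Site d → Fin d → 𝔸ˣ) (lam : Site d → 𝔸) :
    ∀ (x : Site d) (w : List (Letter d)),
      HasDerivAt (fun t : ℂ => ((hol (Mcfg U lam t * U) x w : 𝔸ˣ) : 𝔸)) 0 0
  | x, [] => by simpa using hasDerivAt_const (0 : ℂ) (1 : 𝔸)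
  | x, l :: w => by
    simp only [hol_cons, Units.val_mul]
    exact hasDerivAt_mul_zero (hasDerivAt_stepHol_Mcfg U lam x l) (hasDerivAt_hol_Mcfg U lam (x + l.vec) w)

/-- … and every loop variable `(M_t·U)(Γ_{c,x}∪(−c))` of the average (42). [cite: Balaban1985Averaging, (42) p.23] -/
theorem hasDerivAt_Wcx_Mcfg (L : ℕ) (U : Site d → Fin d → 𝔸ˣ) (lam : Site d → 𝔸) (q : Site d) (κ : Fin d)
    (r : Site d) :
    HasDerivAt (fun t : ℂ => ((Wcx L (Mcfg U lam t * U) q κ r : 𝔸ˣ) : 𝔸)) 0 0 := by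
  simp only [Wcx, Units.val_mul]
  exact hasDerivAt_mul_zero (hasDerivAt_hol_Mcfg U lam q _) (hasDerivAt_val_inv_zero (hasDerivAt_hol_Mcfg U lam q _))

/-- **the logarithms of (42) along the residual** have zero velocity at `0`: inside the domain `‖U(Γ_{c,x}∪(−c)) − 1‖ < 1`
the series `log` (21) is analytic (`MatrixLog.analyticAt_mlog`); chain rule with zero inner velocity (the Fréchet derivative
of `log` at the loop variable is never computed). [cite: Balaban1985Averaging, (42) p.23, (21) p.21] -/
theorem hasDerivAt_mlog_Wcx_Mcfg (L : ℕ) (U : Site d → Fin d → 𝔸ˣ) (lam : Site d → 𝔸) (q : Site d) (κ : Fin d)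
    (r : Site d) (hW : ‖((Wcx L U q κ r : 𝔸ˣ) : 𝔸) - 1‖ < 1) :
    HasDerivAt (fun t : ℂ => mlog ((Wcx L (Mcfg U lam t * U) q κ r : 𝔸ˣ) : 𝔸)) 0 0 := by
  have hA := (analyticAt_mlog hW).differentiableAt.hasFDerivAt
  have h0 : ((Wcx L (Mcfg U lam 0 * U) q κ r : 𝔸ˣ) : 𝔸) = ((Wcx L U q κ r : 𝔸ˣ) : 𝔸) := by
    rw [Mcfg_zero, one_mul]
  rw [← h0] at hA
  simpa [Function.comp_def] using hA.comp_hasDerivAt (0 : ℂ) (hasDerivAt_Wcx_Mcfg L U lam q κ r)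

/-- … hence the exponent `X_c` of (42) has zero velocity along the residual. [cite: Balaban1985Averaging, (42) p.23] -/
theorem hasDerivAt_Xavg_Mcfg (L : ℕ) (U : Site d → Fin d → 𝔸ˣ) (lam : Site d → 𝔸) (q : Site d) (κ : Fin d)
    (hW : ∀ r : Fin d → Fin L, ‖((Wcx L U q κ (boxVec L r) : 𝔸ˣ) : 𝔸) - 1‖ < 1) :
    HasDerivAt (fun t : ℂ => Xavg L (Mcfg U lam t * U) q κ) 0 0 := by
  unfold Xavg
  have h : ∀ r ∈ (Finset.univ : Finset (Fin d → Fin L)),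
      HasDerivAt (fun t : ℂ => (((L : ℝ) ^ d)⁻¹) • mlog ((Wcx L (Mcfg U lam t * U) q κ (boxVec L r) : 𝔸ˣ) : 𝔸))
        ((((L : ℝ) ^ d)⁻¹) • (0 : 𝔸)) 0 :=
    fun r _ => (hasDerivAt_mlog_Wcx_Mcfg L U lam q κ (boxVec L r) (hW r)).const_smul (((L : ℝ) ^ d)⁻¹)
  simpa using HasDerivAt.fun_sum h

/-- **the one-step average (42) of `M_t·U` has zero velocity at `t = 0`** (`exp` is analytic everywhere,
`NormedSpace.exp_analytic`; the straight transport `(M_t·U)(c)` by `hasDerivAt_hol_Mcfg`). [cite: Balaban1985Averaging, (42) p.23] -/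
theorem hasDerivAt_bavg_Mcfg (L : ℕ) (U : Site d → Fin d → 𝔸ˣ) (lam : Site d → 𝔸) (q : Site d) (κ : Fin d)
    (hW : ∀ r : Fin d → Fin L, ‖((Wcx L U q κ (boxVec L r) : 𝔸ˣ) : 𝔸) - 1‖ < 1) :
    HasDerivAt (fun t : ℂ => ((bavg L (Mcfg U lam t * U) q κ : 𝔸ˣ) : 𝔸)) 0 0 := by
  have hE := (exp_analytic (𝕂 := ℂ) (Xavg L U q κ)).differentiableAt.hasFDerivAt
  have h0 : Xavg L (Mcfg U lam 0 * U) q κ = Xavg L U q κ := by rw [Mcfg_zero, one_mul]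
  rw [← h0] at hE
  have hX : HasDerivAt (fun t : ℂ => exp (Xavg L (Mcfg U lam t * U) q κ)) 0 0 := by
    simpa [Function.comp_def] using hE.comp_hasDerivAt (0 : ℂ) (hasDerivAt_Xavg_Mcfg L U lam q κ hW)
  simp only [val_bavg]
  exact hasDerivAt_mul_zero hX (hasDerivAt_hol_Mcfg U lam q _)

/-- **`Ṽ₁` (65) along the residual has zero velocity**: `d/dt|₀ (\overline{M_tU})_c(Ū_c)⁻¹ = 0`.
[cite: Balaban1985Averaging, (65) p.29; Balaban1985BackgroundPropagators, p.418] -/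
theorem hasDerivAt_tild_Mcfg (L : ℕ) (U : Site d → Fin d → 𝔸ˣ) (lam : Site d → 𝔸) (q : Site d) (κ : Fin d)
    (hW : ∀ r : Fin d → Fin L, ‖((Wcx L U q κ (boxVec L r) : 𝔸ˣ) : 𝔸) - 1‖ < 1) :
    HasDerivAt (fun t : ℂ => ((tild L U (Mcfg U lam t) q κ : 𝔸ˣ) : 𝔸)) 0 0 := by
  simp only [tild_apply, Units.val_mul]
  simpa using (hasDerivAt_bavg_Mcfg L U lam q κ hW).mul_const ((((bavg L U q κ)⁻¹ : 𝔸ˣ) : 𝔸))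

/-- **THE MIDDLE FACTOR OF (89) ALONG `e^{tD_Uλ}`** — print's *"(\overline{U′U})_c(Ū_c)⁻¹ = u(c₋)R̄_cu⁻¹(c₊)"* linearised:
by `e^{tD_Uλ} = (M_t)^{v_t}`, the EXACT covariance (93) of [5] (`B7Eq92Concrete.tild_mgauge`) and the zero velocity of
`M̃_t`, the `t`-derivative of `Ṽ₁(c)`, `V₁ = e^{tD_Uλ}`, at `0` is `D = −λ(c₋) + R̄_cλ(c₊)`, `R̄_c = R(Ū_c)`.
[cite: Balaban1985BackgroundPropagators, (3.113)–(3.114) p.418; Balaban1985Averaging, (93) p.32] -/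
theorem hasDerivAt_tild_expCfg_covU (L : ℕ) (U : Site d → Fin d → 𝔸ˣ) (lam : Site d → 𝔸) (q : Site d) (κ : Fin d)
    (hW : ∀ r : Fin d → Fin L, ‖((Wcx L U q κ (boxVec L r) : 𝔸ˣ) : 𝔸) - 1‖ < 1) :
    HasDerivAt (fun t : ℂ => ((tild L U (expCfg (t • covU U lam)) q κ : 𝔸ˣ) : 𝔸))
      (-lam q + conjR (bavg L U q κ) (lam (q + (L : ℤ) • e κ))) 0 := by
  have hval : ∀ t : ℂ, ((tild L U (expCfg (t • covU U lam)) q κ : 𝔸ˣ) : 𝔸)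
      = exp (t • (-lam q)) * ((tild L U (Mcfg U lam t) q κ : 𝔸ˣ) : 𝔸)
          * conjR (bavg L U q κ) (exp (t • lam (q + (L : ℤ) • e κ))) := by
    intro t
    rw [expCfg_covU_eq_mgauge, tild_mgauge, ← map_inv]
    simp only [vcfg, val_inv_expUnit, neg_neg, Units.val_mul, val_expUnit, Rc_apply, conjR_apply, smul_neg]
  simp_rw [hval]
  have h1 := hasDerivAt_exp_smul_zero (-lam q)
  have h2 := hasDerivAt_tild_Mcfg L U lam q κ hW
  have h3 := hasDerivAt_conjR_comp (bavg L U q κ) (hasDerivAt_exp_smul_zero (lam (q + (L : ℤ) • e κ)))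
  have h := (h1.fun_mul h2).fun_mul h3
  refine h.congr_deriv ?_
  simp only [zero_smul, exp_zero, Mcfg_zero, tild_one_right, Units.val_one, conjR_one, mul_one, one_mul, mul_zero,
    add_zero]

/-! ## §3 (3.114): `Q(U)D_Uλ = D_ŪQ′(U)λ` -/

/-- **(3.114) in `HasDerivAt` form** — *"Taking logarithms of both sides, and linear parts in λ, we obtain
(QD^{L⁻¹}λ)(c) = R̄_c(Q′λ)(c₊) − (Q′λ)(c₋) = (D_ŪQ′λ)(c). (3.114)"*: along `t ↦ tD_Uλ` the one-step function (121)/(3.13)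
has `t`-derivative `R̄_c(Q′(U)λ)(c₊) − (Q′(U)λ)(c₋)` at `0` (frames by `B7Prop3GeneralLinear.hasDerivAt_Qcov_of_tild`, middle
factor by `hasDerivAt_tild_expCfg_covU`, telescoping by `FhatCov_covU`), under the log-domain condition on the block's
`L^d` loop variables `U(Γ_{c,x}∪(−c))`. [cite: Balaban1985BackgroundPropagators, (3.114) p.418] -/
theorem hasDerivAt_Qcov_covU (L : ℕ) (hL : 1 ≤ L) (U : Site d → Fin d → 𝔸ˣ) (lam : Site d → 𝔸) (q : Site d)
    (κ : Fin d) (hW : ∀ r : Fin d → Fin L, ‖((Wcx L U q κ (boxVec L r) : 𝔸ˣ) : 𝔸) - 1‖ < 1) :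
    HasDerivAt (fun t : ℂ => Qcov L U (t • covU U lam) q κ)
      (conjR (bavg L U q κ) (Qp L U lam (q + (L : ℤ) • e κ)) - Qp L U lam q) 0 := by
  refine (hasDerivAt_Qcov_of_tild L U (covU U lam) q κ (hasDerivAt_tild_expCfg_covU L U lam q κ hW)).congr_deriv ?_
  rw [FhatCov_covU L hL, FhatCov_covU L hL, conjR_sub]
  abel

/-- **(3.114)** — `Q(U)D_Uλ = D_ŪQ′(U)λ` for the LINEAR PART «L(Q(U)·)_c» (`B7Prop3GeneralLinear.linQcov`, [5] (122)) of
the one-step averaging function (3.13)/(121) over the double-bar average (89) of [5], at a general background `U` whose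
block loop variables lie in the domain of the series logarithm (`R̄_c = R(Ū_c)`, `Ū = bavg L U`; both sides carry the
absorbed factor `Lη` of the print's normalisation). [cite: Balaban1985BackgroundPropagators, (3.114) p.418] -/
theorem linQcov_covU (L : ℕ) (hL : 1 ≤ L) (U : Site d → Fin d → 𝔸ˣ) (lam : Site d → 𝔸) (q : Site d) (κ : Fin d)
    (hW : ∀ r : Fin d → Fin L, ‖((Wcx L U q κ (boxVec L r) : 𝔸ˣ) : 𝔸) - 1‖ < 1) :
    linQcov L U (covU U lam) q κ = conjR (bavg L U q κ) (Qp L U lam (q + (L : ℤ) • e κ)) - Qp L U lam q :=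
  (hasDerivAt_Qcov_covU L hL U lam q κ hW).deriv

/-- **"In particular they imply that the average QA are invariant with respect to gauge transformations λ satisfying
Q′λ = 0, i.e. λ∈N(Q′)"** — for the term `QDλ`: if `(Q′(U)λ)` vanishes at both ends of `c` then `Q(U)D_Uλ(c) = 0`.
[cite: Balaban1985BackgroundPropagators, p.418 (after (3.115))] -/
theorem linQcov_covU_eq_zero_of_Qp (L : ℕ) (hL : 1 ≤ L) (U : Site d → Fin d → 𝔸ˣ) (lam : Site d → 𝔸) (q : Site d)
    (κ : Fin d) (hW : ∀ r : Fin d → Fin L, ‖((Wcx L U q κ (boxVec L r) : 𝔸ˣ) : 𝔸) - 1‖ < 1)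
    (hlo : Qp L U lam q = 0) (hhi : Qp L U lam (q + (L : ℤ) • e κ) = 0) :
    linQcov L U (covU U lam) q κ = 0 := by
  have h0 : conjR (bavg L U q κ) (0 : 𝔸) = 0 := by simp [conjR_apply]
  rw [linQcov_covU L hL U lam q κ hW, hlo, hhi, h0, sub_zero]

/-! ## §4 (3.115): `Q_j(U)D_Uλ = D̄ʲQ′_j(U)λ`, by iteration -/

/-- **(3.115)** — *"Iterating this identity we obtain finally Q_jDλ = D^{Lʲη}_{Ūʲ}Q′_jλ = D̄ʲQ′_jλ, (3.115)"*: for the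
composed linear parts `B7Prop4GeneralLevels.linCovIter` ([5] (127) = (3.15)) over the averaged backgrounds `Ūᵐ =
avgIter L U m`, `linCovIter L U (D_Uλ) j = D_{Ūʲ}(Q′_j(U)λ)` on the level-`j` lattice (read on `ℤ^d`), provided the block
loop variables of every `Ūᵐ`, `m < j`, lie in the domain of the series logarithm; the step `j → j+1` is (3.114) at the
background `Ūʲ` applied to `λ_j = Q′_j(U)λ`. [cite: Balaban1985BackgroundPropagators, (3.115) p.418] -/
theorem linCovIter_covU (L : ℕ) (hL : 1 ≤ L) (U : Site d → Fin d → 𝔸ˣ) (lam : Site d → 𝔸) :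
    ∀ j : ℕ, (∀ m < j, ∀ (q : Site d) (κ : Fin d) (r : Fin d → Fin L),
        ‖((Wcx L (avgIter L U m) q κ (boxVec L r) : 𝔸ˣ) : 𝔸) - 1‖ < 1) →
      linCovIter L U (covU U lam) j = covU (avgIter L U j) (QpIter L U lam j)
  | 0, _ => by rw [linCovIter_zero, avgIter_zero, QpIter_zero]
  | j + 1, h => by
    funext z κ
    rw [linCovIter_succ, linCovIter_covU L hL U lam j fun m hm => h m (Nat.lt_succ_of_lt hm),
      linQcov_covU L hL (avgIter L U j) (QpIter L U lam j) ((L : ℤ) • z) κ (h j (Nat.lt_succ_self j) _ κ),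
      covU_apply, avgIter_succ, rescale_apply, QpIter_succ, QpIter_succ, smul_add]

/-- **(3.115) under the hypotheses of [5] Proposition 2** (`U` valued in an averaging-closed `G ⊂ {|u| ≤ 1, |u⁻¹| ≤ 1}`,
`|U(∂p) − 1| < α₀L^{−2k}`, `C₀α₀ ≤ 1/3`, `2α₀ ≤ c₂′`): the log-domain condition holds at every level `j ≤ k`
(`B7AvgGaugeCovariance.Wcx_avgIter_lt_one`, BY NAME), so `linCovIter L U (D_Uλ) j = D_{Ūʲ}(Q′_j(U)λ)` for all `j ≤ k`.
[cite: Balaban1985BackgroundPropagators, (3.115) p.418; Balaban1985Averaging, Prop. 2 (54) p.26] -/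
theorem linCovIter_covU_of_prop2 [NormOneClass 𝔸] (L : ℕ) (hL : 2 ≤ L) {G : Subgroup 𝔸ˣ} (hG : AvgClosed d L G)
    (k : ℕ) (U : Site d → Fin d → 𝔸ˣ) (hU : ∀ x κ, U x κ ∈ G) {α₀ : ℝ} (hα : 0 < α₀) (hα3 : C0 d * α₀ ≤ 1 / 3)
    (hα2 : 2 * α₀ ≤ c2' d L) (h52 : pdev U < α₀ * (((L : ℝ) ^ k)⁻¹) ^ 2) (lam : Site d → 𝔸) :
    ∀ j ≤ k, linCovIter L U (covU U lam) j = covU (avgIter L U j) (QpIter L U lam j) :=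
  fun j hj => linCovIter_covU L (le_trans one_le_two hL) U lam j fun m hm q κ r =>
    Wcx_avgIter_lt_one L hL hG k U hU hα hα3 hα2 h52 m (le_trans hm.le hj) q κ r

end Literature.MathematicalPhysics.QuantumFieldTheory.Balaban1983to89.B9Eq3114Proof.P12

namespace Literature.MathematicalPhysics.QuantumFieldTheory.Balaban1983to89.B9Eq3114Proof

open B7Prop1Explicit B7Prop2Explicit B7Prop3Flat B7Eq92Concrete MatrixLog B7Prop3GeneralRotated B7Prop3GeneralLinear
  B7Prop3GeneralTild B7Prop4GeneralLevels B7Prop6Flat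
open B7Eq78Linearization (conjR conjR_apply conjR_add conjR_sub conjR_smul conjR_smul_real conjR_one Qprime Qprime_apply
  QprimeIter QprimeIter_zero QprimeIter_succ zdBlocking hasDerivAt_exp_smul_zero)
open B8Ineq132 (covDerivFwd conjR_conjR one_conjR)
open B8Eq119TwistedAxial (bgT)

/-! ## §P05 (seat p05 = R10 seat of record; v3 MERGE owner, G.5-33(ii)) — print's `R̄u` IS [5] (78): the block frame
`\overline{R_yU′} = u(y)(R̄u)⁻¹(y)` and `Ū′_c = (R̄u)(c₋)R̄_c(R̄u)⁻¹(c₊)` with `R̄u = B7Eq99Concrete.R0avg` (the step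
`log X⁻¹ = −log X` that `B9Eq3113Proof.dbavgCov_pureGauge` leaves as a reading), the sentence "Q′ = linear part of R̄u" on
that carrier, (3.114) along print's literal order (group identity first, then `log` and linear parts), the knitting of the
two landed readings of "linear part" (`eq3114` ↔ `B9Eq3113Proof.hasDerivAt_mlog_dbavgCov_uexp`), and the dictionary to the
lit-balaban B9 carrier `B9Eq3169Mu.cod` (the abstract `D̄` of (3.115)/(3.168)) -/

section P05

open B7Eq99Concrete
open B9Eq3113Proof (Qp Qp_eq_sum uexp tHol_pureGauge tild_pureGauge hasDerivAt_mlog_dbavgCov_uexp)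
open B7Eq78Linearization (hasDerivAt_mlog_comp hasDerivAt_inverse_comp_one hasDerivAt_conjR_comp avgStep
  avgStep_eq_mul_exp_sum hasDerivAt_avgStep_of_sum_eq_one)
open scoped Topology

variable {d : ℕ}
variable {𝔸 : Type*} [NormedRing 𝔸] [NormedAlgebra ℂ 𝔸] [CompleteSpace 𝔸]
variable (L : ℕ)

omit [NormedAlgebra ℂ 𝔸] [CompleteSpace 𝔸] in
/-- [folklore] `(R(X)Y : 𝔸) = R(X)(Y : 𝔸)`: the rotation (56) of [5] on units (`Rc`) and on the algebra (`conjR`) agree. -/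
private theorem val_Rc (X Y : 𝔸ˣ) : ((Rc X Y : 𝔸ˣ) : 𝔸) = conjR X (Y : 𝔸) := by
  rw [Rc_apply, Units.val_mul, Units.val_mul, conjR_apply]

omit [NormedAlgebra ℂ 𝔸] [CompleteSpace 𝔸] in
/-- [folklore] `R(X)(−Y) = −R(X)Y`. -/
private theorem conjR_neg (X : 𝔸ˣ) (Y : 𝔸) : conjR X (-Y) = -conjR X Y := by
  rw [conjR_apply, conjR_apply, mul_neg, neg_mul]

/-- **p. 418: "We have (\overline{U′U})_c = u(c₋)Ū_cu⁻¹(c₊)"**, literally (the average [5] (42) of `U′U = U^u` is the gauge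
transform of `Ū`, [5] (11)/(45), for every invertible `u`: `B7Prop6Flat.bavg_gaugeAct_units`; `B9Eq3113Proof.tild_pureGauge`
is the `Ū_c⁻¹`-multiplied form). [cite: Balaban1985BackgroundPropagators, p.418 (display: (U′U)‾_c = u(c₋)Ū_c u⁻¹(c₊))] -/
theorem bavg_pureGauge_mul (U : Site d → Fin d → 𝔸ˣ) (u : Site d → 𝔸ˣ) (q : Site d) (κ : Fin d) :
    bavg L (mgauge U u 1 * U) q κ = u q * bavg L U q κ * (u (q + (L : ℤ) • e κ))⁻¹ := by
  rw [mgauge_mul, one_mul, bavg_gaugeAct_units]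

/-- **`log X⁻¹ = −log X` for the series logarithm (21) of [5]**, for a unit `X` with `‖X − 1‖ < ½` (`X = e^{log X}`,
`X⁻¹ = e^{−log X}`, `‖log X‖ < ln 2`, and `log e^{C} = C` for `‖C‖ < ln 2` — `B7BlockAvgLog.mlog_exp`): the step
"exp[i Σ … log u(y)R u⁻¹(x)] = u(y) exp[−i Σ … log u⁻¹(y)R u(x)] u⁻¹(y)" of p. 418. [cite: Balaban1985Averaging, (21) p.21, (26) p.22] -/
theorem mlog_units_inv {X : 𝔸ˣ} (hX : ‖(X : 𝔸) - 1‖ < 1 / 2) : mlog (((X⁻¹ : 𝔸ˣ) : 𝔸)) = -mlog (X : 𝔸) := by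
  have hX1 : ‖(X : 𝔸) - 1‖ < 1 := hX.trans (by norm_num)
  have hunit : X = expUnit (mlog (X : 𝔸)) := Units.ext (by rw [val_expUnit, exp_mlog hX1])
  have hinv : (((X⁻¹ : 𝔸ˣ) : 𝔸)) = exp (-mlog (X : 𝔸)) := by
    rw [hunit, val_inv_expUnit, val_expUnit, ← hunit]
  have hnorm : ‖-mlog (X : 𝔸)‖ < Real.log 2 := by
    rw [norm_neg]
    refine (norm_mlog_le_neg_log hX1).trans_lt ?_
    have h2 : Real.log 2⁻¹ < Real.log (1 - ‖(X : 𝔸) - 1‖) := Real.log_lt_log (by norm_num) (by linarith)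
    rw [Real.log_inv] at h2
    linarith
  rw [hinv, B7BlockAvgLog.mlog_exp hnorm]

/-- `R̄1 = 1`: the average [5] (78) of the trivial gauge function is trivial (`B7Eq99Concrete.R0avg`).
[cite: Balaban1985Averaging, (78) p.30] -/
theorem R0avg_one_right (V₀ : Site d → Fin d → 𝔸ˣ) (y : Site d) : R0avg L V₀ (1 : Site d → 𝔸ˣ) y = 1 := by
  have h : R0fun V₀ y (1 : Site d → 𝔸ˣ) = fun _ => 1 := funext fun x => by rw [R0fun_apply, Pi.one_apply, map_one]
  rw [R0avg, h, savg_const]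

/-- **the `R0avg` of `B7Eq99Concrete` IS the `avgStep` of `B7Eq78Linearization`** (two typings of [5] (78)
"(R̄₀v)(y) = v(y)exp[iΣ_{x∈B(y)}L^{−d}(1/i) log v⁻¹(y)R(V₀(Γ_{y,x}))v(x)]"), on the block `r ∈ [0,L)^d`, weights `L^{−d}`,
transporters `V₀(Γ_{y,y+r})` — so the tree's "Q′ = linear part of R̄u" (`hasDerivAt_avgStep_of_sum_eq_one`) applies to
`R0avg`. [cite: Balaban1985Averaging, (78) p.30] -/
theorem val_R0avg_eq_avgStep (V₀ : Site d → Fin d → 𝔸ˣ) (v : Site d → 𝔸ˣ) (y : Site d) :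
    (R0avg L V₀ v y : 𝔸) = avgStep (Finset.univ : Finset (Fin d → Fin L)) (fun _ => ((L : ℝ) ^ d)⁻¹)
      (fun r => hol V₀ y (treeWord (boxVec L r))) (v y : 𝔸) (fun r => (v (y + boxVec L r) : 𝔸)) := by
  rw [val_R0avg, avgStep_eq_mul_exp_sum]
  congr 2
  refine Finset.sum_congr rfl fun r _ => ?_
  rw [Units.val_mul, val_Rc, Ring.inverse_unit]

/-- **p. 418, (3.113) evaluated: "\overline{R_yU′} = exp[i Σ_{x∈B(y)} L^{−d}(1/i) log u(y)R(U(Γ_{y,x}))u⁻¹(x)] =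
u(y) exp[−i Σ_{x∈B(y)} L^{−d}(1/i) log u⁻¹(y)R(U(Γ_{y,x}))u(x)] u⁻¹(y) = u(y)(R̄u)⁻¹(y)"** with `R̄u` THE AVERAGE (78) OF [5]
(`B7Eq99Concrete.R0avg`; `B9Eq3113Proof.dbavgCov_pureGauge` reads `(R̄u)(y) := \overline{R_yU′}⁻¹u(y)` instead): the block
frame [5] (82) (`wframe`) of the pure gauge `U′ = u·R(U)u⁻¹` is `u(y)(R̄u)(y)⁻¹`, under the domain condition
`‖u⁻¹(y)R(U(Γ_{y,x}))u(x) − 1‖ < ½` on the block (`log X⁻¹ = −log X`, `mlog_units_inv`; the conjugation by `u(y)` passes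
through the series (21) and `exp` with no condition). [cite: Balaban1985BackgroundPropagators, (3.113) p.418] -/
theorem wframe_pureGauge_R0avg (U : Site d → Fin d → 𝔸ˣ) (u : Site d → 𝔸ˣ) (y : Site d)
    (hM : ∀ r : Fin d → Fin L,
      ‖((((u y)⁻¹ * Rc (hol U y (treeWord (boxVec L r))) (u (y + boxVec L r)) : 𝔸ˣ)) : 𝔸) - 1‖ < 1 / 2) :
    wframe L U (mgauge U u 1) y = u y * (R0avg L U u y)⁻¹ := by
  letI : NormedAlgebra ℚ 𝔸 := NormedAlgebra.restrictScalars ℚ ℂ 𝔸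
  -- the exponent, termwise: `log(u(y)·X⁻¹) = u(y)·(−log(u(y)⁻¹X))·u(y)⁻¹`
  have hF : Fcov L U (mgauge U u 1) y = (u y : 𝔸) * (-Sexp L (R0fun U y u) y) * (((u y)⁻¹ : 𝔸ˣ) : 𝔸) := by
    rw [Fcov, Sexp_apply, R0fun_self, ← Finset.sum_neg_distrib, Finset.mul_sum, Finset.sum_mul]
    refine Finset.sum_congr rfl fun r _ => ?_
    rw [tHol_pureGauge, disp_treeWord, R0fun_add]
    set M : 𝔸ˣ := (u y)⁻¹ * Rc (hol U y (treeWord (boxVec L r))) (u (y + boxVec L r)) with hMdef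
    have hconj : u y * (Rc (hol U y (treeWord (boxVec L r))) (u (y + boxVec L r)))⁻¹ = u y * M⁻¹ * (u y)⁻¹ := by
      rw [hMdef, mul_inv_rev, inv_inv, ← mul_assoc, mul_inv_cancel_right]
    rw [hconj, Units.val_mul, Units.val_mul, B7Prop6Flat.mlog_conj, mlog_units_inv (hM r), ← smul_neg, mul_smul_comm,
      smul_mul_assoc, mul_neg, neg_mul]
  apply Units.ext
  rw [wframe, val_expUnit, hF, exp_units_conj, Units.val_mul, R0avg, savg_apply, R0fun_self, mul_inv_rev,
    val_inv_expUnit, Units.val_mul, val_expUnit, mul_assoc]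

/-- **p. 418: "hence Ū′_c = (R̄u)(c₋)R̄_c(R̄u)⁻¹(c₊)"** with `R̄u` THE AVERAGE (78) OF [5] (`R0avg`): the one-step average
[5] (89) of the pure gauge `U′ = u·R(U)u⁻¹`, under the domain condition of `wframe_pureGauge_R0avg` on `B(c₋)` and `B(c₊)`.
[cite: Balaban1985BackgroundPropagators, p.418 (display: Ū′_c = (R̄u)(c₋)R̄_c(R̄u)⁻¹(c₊))] -/
theorem dbavgCov_pureGauge_R0avg (U : Site d → Fin d → 𝔸ˣ) (u : Site d → 𝔸ˣ) (q : Site d) (κ : Fin d)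
    (hM : ∀ r : Fin d → Fin L,
      ‖((((u q)⁻¹ * Rc (hol U q (treeWord (boxVec L r))) (u (q + boxVec L r)) : 𝔸ˣ)) : 𝔸) - 1‖ < 1 / 2)
    (hM' : ∀ r : Fin d → Fin L,
      ‖((((u (q + (L : ℤ) • e κ))⁻¹ * Rc (hol U (q + (L : ℤ) • e κ) (treeWord (boxVec L r)))
        (u (q + (L : ℤ) • e κ + boxVec L r)) : 𝔸ˣ)) : 𝔸) - 1‖ < 1 / 2) :
    dbavgCov L U (mgauge U u 1) q κ = R0avg L U u q * Rc (bavg L U q κ) (R0avg L U u (q + (L : ℤ) • e κ))⁻¹ := by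
  rw [dbavgCov_apply, wframe_pureGauge_R0avg L U u q hM, wframe_pureGauge_R0avg L U u _ hM', tild_pureGauge, map_mul,
    map_inv, mul_inv_rev, inv_inv]
  simp only [mul_assoc, inv_mul_cancel_left]

/-- **B9 p. 394 / [5] (78): "the averaging operators Q′_j(U) are linear parts of the averaging operations R̄u"** on the
`R0avg` carrier, one step, along `u_t = e^{tλ}`: `d/dt|₀ (R̄u_t)(y) = (Q′(U)λ)(y)` (`Q′` = `B9Eq3113Proof.Qp`; the weights
`L^{−d}` sum to `1` for `L ≥ 1`). [cite: Balaban1985BackgroundPropagators, (3.19) p.393, p.394 (sentence after (3.19))] -/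
theorem hasDerivAt_R0avg_expGauge (hL : 1 ≤ L) (U : Site d → Fin d → 𝔸ˣ) (lam : Site d → 𝔸) (y : Site d) :
    HasDerivAt (fun t : ℂ => ((R0avg L U (fun x => expUnit (t • lam x)) y : 𝔸ˣ) : 𝔸)) (Qp L U lam y) 0 := by
  simp_rw [val_R0avg_eq_avgStep, val_expUnit]
  exact hasDerivAt_avgStep_of_sum_eq_one _ _ _ (sum_weights L hL) (by simp) (fun _ _ => by simp)
    (hasDerivAt_exp_smul_zero (lam y)) (fun r _ => hasDerivAt_exp_smul_zero (lam (y + boxVec L r)))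

/-- the domain condition of `wframe_pureGauge_R0avg` holds along `u_t = e^{tλ}` for `t` near `0` (finitely many continuous
functions of `t`, all `= 1` at `t = 0`). [cite: Balaban1985BackgroundPropagators, (3.113) p.418] -/
theorem eventually_logDomain_expGauge (U : Site d → Fin d → 𝔸ˣ) (lam : Site d → 𝔸) (y : Site d) :
    ∀ᶠ t : ℂ in 𝓝 0, ∀ r : Fin d → Fin L,
      ‖((((expUnit (t • lam y))⁻¹ * Rc (hol U y (treeWord (boxVec L r))) (expUnit (t • lam (y + boxVec L r))) : 𝔸ˣ))
        : 𝔸) - 1‖ < 1 / 2 := by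
  refine Filter.eventually_all.2 fun r => ?_
  have hc : ContinuousAt (fun t : ℂ => ((((expUnit (t • lam y))⁻¹
      * Rc (hol U y (treeWord (boxVec L r))) (expUnit (t • lam (y + boxVec L r))) : 𝔸ˣ)) : 𝔸)) 0 := by
    have h := ((hasDerivAt_exp_smul_zero (-lam y)).mul (hasDerivAt_conjR_comp
      (hol U y (treeWord (boxVec L r))) (hasDerivAt_exp_smul_zero (lam (y + boxVec L r))))).continuousAt
    refine h.congr (Filter.Eventually.of_forall fun t => ?_)
    simp only [Pi.mul_apply, Units.val_mul, val_inv_expUnit, val_Rc, val_expUnit, smul_neg]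
  have h0 : ((((expUnit ((0 : ℂ) • lam y))⁻¹
      * Rc (hol U y (treeWord (boxVec L r))) (expUnit ((0 : ℂ) • lam (y + boxVec L r))) : 𝔸ˣ)) : 𝔸) - 1 = 0 := by
    simp only [Units.val_mul, val_inv_expUnit, val_Rc, val_expUnit, zero_smul, neg_zero, exp_zero, conjR_one, mul_one,
      sub_self]
  have hlt : ‖((((expUnit ((0 : ℂ) • lam y))⁻¹
      * Rc (hol U y (treeWord (boxVec L r))) (expUnit ((0 : ℂ) • lam (y + boxVec L r))) : 𝔸ˣ)) : 𝔸) - 1‖ < 1 / 2 := by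
    rw [h0, norm_zero]; norm_num
  exact (hc.sub continuousAt_const).norm.eventually_lt continuousAt_const hlt

/-- **(3.114) ALONG PRINT'S LITERAL ORDER** — *"hence Ū′_c = (R̄u)(c₋)R̄_c(R̄u)⁻¹(c₊). Taking logarithms of both sides, and
linear parts in λ, we obtain (QD^{L⁻¹}λ)(c) = R̄_c(Q′λ)(c₊) − (Q′λ)(c₋) = (D_ŪQ′λ)(c). (3.114)"*: along `u_t = e^{tλ}` the average
`Ū′_c(t)` ([5] (89)) of the pure gauge COINCIDES near `t = 0` with `(R̄u_t)(c₋)R̄_c(R̄u_t)⁻¹(c₊)`, `R̄` = (78)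
(`dbavgCov_pureGauge_R0avg`, `eventually_logDomain_expGauge`), whose logarithm has derivative `(Q′λ)(c₋) − R̄_c(Q′λ)(c₊)`
(`hasDerivAt_R0avg_expGauge`); the pure gauge of `e^{tλ}` has bond velocity `−D_Uλ` (print's `A^λ = A − Dλ`), so this is
(3.114) with both sides negated — the same derivative as `B9Eq3113Proof.hasDerivAt_mlog_dbavgCov_uexp` (there along
`e^{−tλ}`, by differentiating the three factors of (89) directly). [cite: Balaban1985BackgroundPropagators, (3.114) p.418] -/
theorem hasDerivAt_mlog_dbavgCov_expGauge (hL : 1 ≤ L) (U : Site d → Fin d → 𝔸ˣ) (lam : Site d → 𝔸) (q : Site d)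
    (κ : Fin d) :
    HasDerivAt (fun t : ℂ => mlog ((dbavgCov L U (mgauge U (fun x => expUnit (t • lam x)) 1) q κ : 𝔸ˣ) : 𝔸))
      (Qp L U lam q - conjR (bavg L U q κ) (Qp L U lam (q + (L : ℤ) • e κ))) 0 := by
  have hu0 : (fun x => expUnit ((0 : ℂ) • lam x)) = (1 : Site d → 𝔸ˣ) := funext fun x => Units.ext (by simp)
  have h0 : ∀ y, ((R0avg L U (fun x => expUnit ((0 : ℂ) • lam x)) y : 𝔸ˣ) : 𝔸) = 1 := fun y => by
    rw [hu0, R0avg_one_right, Units.val_one]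
  -- the right-hand side of "hence" and its derivative
  have h1 := hasDerivAt_R0avg_expGauge L hL U lam q
  have h2 := hasDerivAt_inverse_comp_one (h0 _) (hasDerivAt_R0avg_expGauge L hL U lam (q + (L : ℤ) • e κ))
  have h := h1.mul (hasDerivAt_conjR_comp (bavg L U q κ) h2)
  have hval : ∀ t : ℂ, ((R0avg L U (fun x => expUnit (t • lam x)) q
        * Rc (bavg L U q κ) (R0avg L U (fun x => expUnit (t • lam x)) (q + (L : ℤ) • e κ))⁻¹ : 𝔸ˣ) : 𝔸)
      = ((R0avg L U (fun x => expUnit (t • lam x)) q : 𝔸ˣ) : 𝔸) * conjR (bavg L U q κ)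
          (Ring.inverse ((R0avg L U (fun x => expUnit (t • lam x)) (q + (L : ℤ) • e κ) : 𝔸ˣ) : 𝔸)) := by
    intro t
    rw [Units.val_mul, val_Rc, Ring.inverse_unit]
  have hR : HasDerivAt (fun t : ℂ => mlog ((R0avg L U (fun x => expUnit (t • lam x)) q
        * Rc (bavg L U q κ) (R0avg L U (fun x => expUnit (t • lam x)) (q + (L : ℤ) • e κ))⁻¹ : 𝔸ˣ) : 𝔸))
      (Qp L U lam q - conjR (bavg L U q κ) (Qp L U lam (q + (L : ℤ) • e κ))) 0 := by
    simp_rw [hval]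
    refine hasDerivAt_mlog_comp (by rw [h0, h0, Ring.inverse_one, conjR_one, mul_one]) (h.congr_deriv ?_)
    rw [h0, h0, Ring.inverse_one, conjR_one, mul_one, one_mul, conjR_neg, sub_eq_add_neg]
  -- "both sides" agree near `t = 0`
  refine hR.congr_of_eventuallyEq ?_
  filter_upwards [eventually_logDomain_expGauge L U lam q, eventually_logDomain_expGauge L U lam (q + (L : ℤ) • e κ)]
    with t ht ht'
  rw [dbavgCov_pureGauge_R0avg L U (fun x => expUnit (t • lam x)) q κ ht ht']

/-- **THE TWO LANDED READINGS OF (3.114) AGREE**: the derivative-defined linear part «L(Q(U)·)_c» of [5] (121)–(122) at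
`A = D_Uλ` (`eq3114`, along `e^{tD_Uλ}`) equals the `t`-derivative at `0` of `log Ū′_c` along the pure gauges of
`u_t = e^{−tλ}` (`B9Eq3113Proof.hasDerivAt_mlog_dbavgCov_uexp`, whose bond velocity is `+D_Uλ`), under the loop condition on
`B(c₋)` — print's "linear parts in λ" of the left-hand side read either way. [cite: Balaban1985BackgroundPropagators, (3.114) p.418] -/
theorem linQcov_covD_eq_deriv_pureGauge [NormOneClass 𝔸] (hL : 1 ≤ L) (U : Site d → Fin d → 𝔸ˣ) (lam : Site d → 𝔸)
    (q : Site d) (κ : Fin d) (hW : ∀ r : Fin d → Fin L, ‖((Wcx L U q κ (boxVec L r) : 𝔸ˣ) : 𝔸) - 1‖ < 1) :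
    linQcov L U (fun z μ => covDerivFwd 1 U μ lam z) q κ
      = deriv (fun t : ℂ => mlog ((dbavgCov L U (mgauge U (uexp lam t) 1) q κ : 𝔸ˣ) : 𝔸)) 0 := by
  rw [(hasDerivAt_mlog_dbavgCov_uexp L hL U lam q κ).deriv, eq3114 L hL U lam q κ hW, Qp_eq_sum, Qp_eq_sum]

end P05

/-! ### Dictionary to the lit-balaban B9 carrier `B9Eq3169Mu.cod` (the abstract `D̄μ(b) = R(V(b))μ(b₊) − μ(b₋)` typed
there for (3.115)/(3.168)): the `D̄ʲ = D¹_{Ūʲ}` of `eq3114_zd`/`eq3115` IS that carrier's `cod` on the bond set `ℤᵈ × Fin d`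
with the conjugation transports — so (3.114)/(3.115) above are statements about the row's model `D̄`. -/

section Dictionary

variable {d : ℕ}
variable {𝔹 : Type} [NormedRing 𝔹] [NormedAlgebra ℂ 𝔹]

/-- the rotation `R(X)Y = XYX⁻¹` (p. 390 "R(U)X = UXU⁻¹"; [5] (56)) as an `ℝ`-linear automorphism of the algebra — the bond
transports `R b : 𝔤 ≃ₗ[ℝ] 𝔤` that `B9Eq3169Mu` takes as data. [cite: Balaban1985BackgroundPropagators, p.390 (R(U)X = UXU⁻¹)] -/
def conjEquiv (X : 𝔹ˣ) : 𝔹 ≃ₗ[ℝ] 𝔹 where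
  toFun := conjR X
  invFun := conjR X⁻¹
  map_add' := conjR_add X
  map_smul' c Y := by rw [conjR_smul_real, RingHom.id_apply]
  left_inv Y := by rw [conjR_conjR, inv_mul_cancel, one_conjR]
  right_inv Y := by rw [conjR_conjR, mul_inv_cancel, one_conjR]

/-- `conjEquiv X Y = R(X)Y`. [cite: Balaban1985BackgroundPropagators, p.390 (R(U)X = UXU⁻¹)] -/
@[simp] theorem conjEquiv_apply (X : 𝔹ˣ) (Y : 𝔹) : conjEquiv X Y = conjR X Y := rfl

/-- **`D¹_W = B9Eq3169Mu.cod`**: the forward covariant derivative at `η = 1` of the b08 lineage (`B8Ineq132.covDerivFwd 1`,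
the `D`/`D̄ʲ` of `eq3114`/`eq3115`) is the abstract `D̄` of the lit-balaban B9 carrier on the bonds `(x, κ) = ⟨x, x + e_κ⟩` of
`ℤᵈ`, transports `R(W(b))`. [cite: Balaban1985BackgroundPropagators, p.390 (display: D^η_{U₀}), (3.115) p.418] -/
theorem covDerivFwd_one_eq_cod (W : Site d → Fin d → 𝔹ˣ) (mu : Site d → 𝔹) (x : Site d) (κ : Fin d) :
    covDerivFwd 1 W κ mu x = B9Eq3169Mu.cod (fun b : Site d × Fin d => conjEquiv (W b.1 b.2)) (fun b => b.1)
      (fun b => b.1 + e b.2) mu (x, κ) := by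
  rw [B9Eq3169Mu.cod_apply, conjEquiv_apply, covDerivFwd_one]

/-- **(3.114) on the row's model**: `(QD^{L⁻¹}λ)(c) = (D̄Q′λ)(c)` with `D̄ = B9Eq3169Mu.cod` over the averaged background
`Ū = avgIter L V 1` on the coarse bonds `c = ⟨y, y + e_κ⟩` of `ℤᵈ` and `Q′ = QprimeIter (zdBlocking d L) (bgT L V) 1`
(`eq3114_zd` + `covDerivFwd_one_eq_cod`), under the loop condition on `B(c₋)`. [cite: Balaban1985BackgroundPropagators, (3.114) p.418] -/
theorem eq3114_cod [NormOneClass 𝔹] [CompleteSpace 𝔹] (L : ℕ) (hL : 1 ≤ L) (V : Site d → Fin d → 𝔹ˣ)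
    (lam : Site d → 𝔹) (y : Site d) (κ : Fin d)
    (hW : ∀ r : Fin d → Fin L, ‖((Wcx L V ((L : ℤ) • y) κ (boxVec L r) : 𝔹ˣ) : 𝔹) - 1‖ < 1) :
    linQcov L V (fun z μ => covDerivFwd 1 V μ lam z) ((L : ℤ) • y) κ
      = B9Eq3169Mu.cod (fun b : Site d × Fin d => conjEquiv (avgIter L V 1 b.1 b.2)) (fun b => b.1)
          (fun b => b.1 + e b.2) (QprimeIter (zdBlocking d L) (bgT L V) 1 lam) (y, κ) := by
  rw [eq3114_zd L hL V lam y κ hW, covDerivFwd_one_eq_cod]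

end Dictionary

end Literature.MathematicalPhysics.QuantumFieldTheory.Balaban1983to89.B9Eq3114Proof

end
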